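import Literature.NumberTheory.LFunctions.MontgomeryOdlyzkoCriterionBHProofs
import Literature.NumberTheory.LFunctions.MontgomeryOdlyzkoResonatorSums
import Literature.NumberTheory.Sieve.PrimePowersInProgressions
import Mathlib.NumberTheory.ArithmeticFunction.Liouville
import HarnessLib

/-!
# Montgomery–Odlyzko 1984: `RH ⇒ μ < 0.5179` — discharge of `montgomeryOdlyzko1984_smallGaps`

`theorem montgomeryOdlyzko1984_smallGaps_holds : montgomeryOdlyzko1984_smallGaps`, i.e. under the
Riemann Hypothesis `lim inf (γ_{n+1} − γ_n) log γ_n/(2π) < 0.5179`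
[cite: MontgomeryOdlyzko1984, main theorem as quoted in BuiMilinovichNg2010 §2 p. 3], the
statement typed AS QUOTED in `ZetaGapRecordsRH.lean` (rh-crit; untouched here).

Proof = the Montgomery–Odlyzko method as re-derived in the tree:
* the kernel criterion `montgomeryOdlyzko1984_criterion_of_margin` (RH; `h(c) ≥ 1 + η` for all
  large `T` with resonator length `y = T^{1−δ}` ⇒ `μ ≤ c`), applied at `c₀ = 0.51789 < 0.5179`
  (`ZetaGapLiminfLe.below_of_lt`);
* with Montgomery–Odlyzko's OWN coefficient family for small gaps, `a(n) = λ(n)·f(log n/log y)/√n`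
  (`λ` the Liouville function; Bui–Milinovich–Ng 2010 §2 quoting [MO84]: "by optimizing over such
  functions `f`, the values `μ < 0.5179` … are obtained"), here with the near-optimal quadratic
  `f(u) = w(u) = 1 + (9/20)u(1−u)` (limit functional `h∞(c₀) = 1.000144…`; the optimum over all
  `f` crosses `1` at `c* = 0.51780…`, whose rounding up is the printed `0.5179`);
* §2 the unfolded identity `(π/2)·Re 𝔪(a) = Σ_{k ≤ y} (Λ(k)λ(k)/(k log k))·sin(a₀ log k/log y)·S_k`,
  `S_k = Σ_{m ≤ y/k} w(log m/log y) w(log(km)/log y)/m` (`λ(n/k)λ(n) = λ(k)`, divisor swap), and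
  `Σ|a(n)|² = Σ_{k ≤ y} w(log k/log y)²/k`;
* §3 the RH-free asymptotics of these sums from `MontgomeryOdlyzkoResonatorSums.lean` (A1)–(A3):
  (H1) `Σ w²/k ≤ I₂ log y + C₁`, (H2) `S_p ≥ F(log p/log y) log y − C₂` on primes, with
  `I₂ = ∫₀¹ w² = 4627/4000` and the profile `F(v) = ∫₀^{1−v} w(u)w(u+v) du =
  4627/4000 − v − (387/800)v² + (267/800)v³ − (27/4000)v⁵`; the prime-power tail and the
  `k`-sum with `|sin x| ≤ |x|` are `O(1)`;
* §4 the ONE-SIDED engine: since `F ≥ 0` on `[0,1]` and `0 ≤ a₀ ≤ π`, `sin(a₀v) ≥ T₁₁(a₀v)`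
  (§1, the alternating Taylor bound) turns the prime sum into monomial prime sums
  `Σ_p (log p/p)(log p/log y)^n`, evaluated by (A2) uniformly in `n`; whence
  `h(c₀) ≥ c₀ + (2/π)(ρ(a₀)/I₂ − ε)` for `log y` large, `ρ(a₀) = ∫₀¹ T₁₁(a₀v)F(v)v⁻¹dv` a rational;
* §5 the rational certificate `c₀ + (2/3.141593)(ρ(a₀)/I₂ − 10⁻⁴) ≥ 1 + 1/20000` (`norm_num`) and
  the closer.

DECLARED DEVIATIONS FROM PRINT (harmless for the typed statement, which is the NUMBER 0.5179):
(i) resonator length `y = T^{θ₀}`, `θ₀ = a₀/(πc₀)` with `a₀ = 1.62699` (the tree criterion's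
`T^{1−δ}`), instead of Montgomery–Odlyzko's `K = T(log T)^{−2}` — this costs only the factor `θ₀`
inside the sine, absorbed by the choice of `θ₀` (so that `πc₀θ₀ = a₀` is rational); (ii) the
quadratic weight instead of their modified Bessel function (any admissible `f` with `h(c₀) > 1`
proves the record as typed). Plan, numerics and tree inventory: dossier of seat rh-crit-ah-t4 g7,
`pub/rh-crit/ah/rh-crit-ah-t4/MO84-MU-DOSSIER.md` (sha16 01149b77908f51ba); limit functional
re-checked independently by ls-lit-r2 g6. NOT RH-BEARING: RH is the ANTECEDENT of the record.
No definition, no named fact; theorems only (helpers private).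

## §6–§7 (seat ls-lit-r2 g7): the λ-twin `RH ⇒ λ > 1.9799`

`theorem montgomeryOdlyzko1984_largeGaps_holds : montgomeryOdlyzko1984_largeGaps`
(`RiemannHypothesis → ZetaGapLimsupAbove 1.9799`, typed AS QUOTED in `ZetaGapRecordsRH.lean`,
untouched) [cite: MontgomeryOdlyzko1984, main theorem as quoted in FengWu2012 §1 p. 2], by the same
method with the LARGE-gap half of the kernel criterion for every `0 < δ < 1`
(`montgomeryOdlyzko1984_criterion_largeGaps_of_margin'`, Bondarenko–Heap road) and
Montgomery–Odlyzko's UNTWISTED family `a(n) = w(log n/log y)/√n` (Bui–Milinovich–Ng 2010 §2: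
"`a_k = k^{−1/2} f(log k/log K)` … `λ > 1.97[99]`"), here with the near-optimal quartic
`w(u) = 1 + (13/2)u(1−u) + 22(u(1−u))²`: §6 the untwisted unfolding, (H1)/(H2) of any degree
((H2) two-sided), the engine `MO84.moValue_plain_le` (`sin ≥ T₂₇` on `[0,∞)` applied against
`S_p ≥ 0`, since `a₀v ≤ a₀ = 6.22 > π` changes the sign of `sin`); §7 the rational certificate
`c₀ − (2/3.141593)(ρ₂₇(a₀,F)/I₂ − 10⁻⁶) ≤ 1 − 10⁻⁵` at `c₀ = 1.97994`, `a₀ = 311/50`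
(`I₂ = 3187/360`, `F(v) = 3187/360 − v − (4651/168)v² − (79/24)v³ + (1859/30)v⁴ − (5449/120)v⁵
+ (22/3)v⁷ − (242/315)v⁹`; slack `2.9·10⁻⁵`) and the closer at `c' = 1.9799 < c₀`. Landscape
(seat numerics, folder `num/`): the optimum over all weights is the prolate spheroidal function,
`inf_w h∞(c) = c − λ₀(πcθ/2)` with `λ₀` Slepian's concentration eigenvalue on `[−1,1]`, crossing
`1` at `c* = 1.97998…` (`θ → 1`) — Montgomery–Odlyzko's `1.9799` is this optimum rounded down.
-/

noncomputable section

open MeasureTheory Set Finset Real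

open scoped ArithmeticFunction.vonMangoldt ArithmeticFunction.Omega

namespace Literature.NumberTheory.LFunctions

namespace MO84

open GoldstonTrudgianTurnageButterbaugh2023 InoueKobayashiToma2025

/-! ### §1. (A4) The alternating Taylor bound for `sin` on `[0, ∞)` (private sign kernel)

Copy of the private kernel of `BondarenkoHeap2026Numerics.lean` §1 (same statements; private here too). -/

/-- `d/dx Σ_{n≤N} (−1)ⁿx^{2n+1}/(2n+1)! = Σ_{n≤N} (−1)ⁿx^{2n}/(2n)!`. [folklore] -/
private theorem hasDerivAt_sinTaylor (N : ℕ) (x : ℝ) :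
    HasDerivAt (fun y : ℝ => ∑ n ∈ range (N + 1), (-1 : ℝ) ^ n * y ^ (2 * n + 1) / ((2 * n + 1).factorial : ℝ))
      (∑ n ∈ range (N + 1), (-1 : ℝ) ^ n * x ^ (2 * n) / ((2 * n).factorial : ℝ)) x := by
  apply HasDerivAt.fun_sum
  intro n _
  refine (((hasDerivAt_pow (2 * n + 1) x).const_mul ((-1 : ℝ) ^ n)).div_const ((2 * n + 1).factorial : ℝ)).congr_deriv ?_
  rw [Nat.factorial_succ, Nat.add_sub_cancel]
  have h1 : ((2 * n).factorial : ℝ) ≠ 0 := by positivity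
  push_cast
  field_simp

/-- `d/dx Σ_{n≤N+1} (−1)ⁿx^{2n}/(2n)! = −Σ_{n≤N} (−1)ⁿx^{2n+1}/(2n+1)!`. [folklore] -/
private theorem hasDerivAt_cosTaylor (N : ℕ) (x : ℝ) :
    HasDerivAt (fun y : ℝ => ∑ n ∈ range (N + 2), (-1 : ℝ) ^ n * y ^ (2 * n) / ((2 * n).factorial : ℝ))
      (-(∑ n ∈ range (N + 1), (-1 : ℝ) ^ n * x ^ (2 * n + 1) / ((2 * n + 1).factorial : ℝ))) x := by
  have h : HasDerivAt (fun y : ℝ => ∑ n ∈ range (N + 2), (-1 : ℝ) ^ n * y ^ (2 * n) / ((2 * n).factorial : ℝ))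
      (∑ n ∈ range (N + 2), (-1 : ℝ) ^ n * (((2 * n : ℕ) : ℝ) * x ^ (2 * n - 1)) / ((2 * n).factorial : ℝ)) x := by
    apply HasDerivAt.fun_sum
    intro n _
    exact ((hasDerivAt_pow (2 * n) x).const_mul ((-1 : ℝ) ^ n)).div_const _
  refine h.congr_deriv ?_
  rw [Finset.sum_range_succ' (fun n => (-1 : ℝ) ^ n * (((2 * n : ℕ) : ℝ) * x ^ (2 * n - 1)) / ((2 * n).factorial : ℝ))]
  simp only [mul_zero, Nat.cast_zero, zero_mul, zero_div, add_zero]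
  rw [← Finset.sum_neg_distrib]
  refine Finset.sum_congr rfl fun n _ => ?_
  have e1 : 2 * (n + 1) - 1 = 2 * n + 1 := by omega
  have e2 : (2 * (n + 1)).factorial = (2 * n + 2) * (2 * n + 1).factorial := by
    rw [show 2 * (n + 1) = (2 * n + 1) + 1 by ring, Nat.factorial_succ]
  rw [e1, e2, pow_succ (-1 : ℝ) n]
  have h1 : ((2 * n + 1).factorial : ℝ) ≠ 0 := by positivity
  have h2 : (2 * (n : ℝ) + 2) ≠ 0 := by positivity
  push_cast
  field_simp

/-- A function vanishing at `0` whose derivative is `≥ 0` on `[0, ∞)` is `≥ 0` on `[0, ∞)`. [folklore] -/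
private theorem nonneg_of_hasDerivAt_nonneg {g g' : ℝ → ℝ} (hd : ∀ x, HasDerivAt g (g' x) x)
    (hg' : ∀ x, 0 ≤ x → 0 ≤ g' x) (h0 : g 0 = 0) (x : ℝ) (hx : 0 ≤ x) : 0 ≤ g x := by
  have hmono : MonotoneOn g (Set.Ici 0) :=
    monotoneOn_of_hasDerivWithinAt_nonneg (convex_Ici 0) (fun y _ => (hd y).continuousAt.continuousWithinAt)
      (fun y _ => (hd y).hasDerivWithinAt) (fun y hy => hg' y (le_of_lt (by simpa [interior_Ici] using hy)))
  simpa [h0] using hmono Set.self_mem_Ici hx hx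

/-- Sign of the `cos` remainder of order `2N` ⇒ sign of the `sin` remainder of order `2N+1`
(integrate from `0`). [folklore] -/
private theorem sinTaylor_sign_of_cosTaylor_sign (N : ℕ)
    (h : ∀ x : ℝ, 0 ≤ x →
      0 ≤ (-1 : ℝ) ^ (N + 1) * (Real.cos x - ∑ n ∈ range (N + 1), (-1 : ℝ) ^ n * x ^ (2 * n) / ((2 * n).factorial : ℝ))) :
    ∀ x : ℝ, 0 ≤ x →
      0 ≤ (-1 : ℝ) ^ (N + 1) * (Real.sin x - ∑ n ∈ range (N + 1), (-1 : ℝ) ^ n * x ^ (2 * n + 1) / ((2 * n + 1).factorial : ℝ)) :=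
  nonneg_of_hasDerivAt_nonneg (fun x => ((Real.hasDerivAt_sin x).sub (hasDerivAt_sinTaylor N x)).const_mul _) h
    (by simp)

/-- Sign of the `sin` remainder of order `2N+1` ⇒ sign of the `cos` remainder of order `2N+2`
(integrate from `0`). [folklore] -/
private theorem cosTaylor_sign_succ_of_sinTaylor_sign (N : ℕ)
    (h : ∀ x : ℝ, 0 ≤ x →
      0 ≤ (-1 : ℝ) ^ (N + 1) * (Real.sin x - ∑ n ∈ range (N + 1), (-1 : ℝ) ^ n * x ^ (2 * n + 1) / ((2 * n + 1).factorial : ℝ))) :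
    ∀ x : ℝ, 0 ≤ x →
      0 ≤ (-1 : ℝ) ^ (N + 2) * (Real.cos x - ∑ n ∈ range (N + 2), (-1 : ℝ) ^ n * x ^ (2 * n) / ((2 * n).factorial : ℝ)) := by
  refine nonneg_of_hasDerivAt_nonneg (fun x => ((Real.hasDerivAt_cos x).sub (hasDerivAt_cosTaylor N x)).const_mul _)
    (fun x hx => ?_) (by simp [Finset.sum_range_succ'])
  have e : (-1 : ℝ) ^ (N + 2) *
      (-Real.sin x - -(∑ n ∈ range (N + 1), (-1 : ℝ) ^ n * x ^ (2 * n + 1) / ((2 * n + 1).factorial : ℝ)))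
      = (-1 : ℝ) ^ (N + 1) *
        (Real.sin x - ∑ n ∈ range (N + 1), (-1 : ℝ) ^ n * x ^ (2 * n + 1) / ((2 * n + 1).factorial : ℝ)) := by
    rw [pow_succ]; ring
  rw [e]; exact h x hx

/-- For `x ≥ 0` the remainder `cos x − Σ_{n≤N} (−1)ⁿx^{2n}/(2n)!` has the sign `(−1)^{N+1}` of the
first omitted term. [folklore] -/
private theorem cosTaylor_sign : ∀ (N : ℕ) (x : ℝ), 0 ≤ x →
    0 ≤ (-1 : ℝ) ^ (N + 1) * (Real.cos x - ∑ n ∈ range (N + 1), (-1 : ℝ) ^ n * x ^ (2 * n) / ((2 * n).factorial : ℝ))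
  | 0, x, _ => by
    have := Real.cos_le_one x
    simp only [zero_add, pow_one, Finset.sum_range_one, pow_zero, mul_zero, Nat.factorial_zero, Nat.cast_one,
      div_one, mul_one]
    linarith
  | N + 1, x, hx =>
    cosTaylor_sign_succ_of_sinTaylor_sign N (sinTaylor_sign_of_cosTaylor_sign N fun y hy => cosTaylor_sign N y hy) x hx

/-- For `x ≥ 0` the remainder `sin x − Σ_{n≤N} (−1)ⁿx^{2n+1}/(2n+1)!` has the sign `(−1)^{N+1}` of
the first omitted term. [folklore] -/
private theorem sinTaylor_sign (N : ℕ) (x : ℝ) (hx : 0 ≤ x) :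
    0 ≤ (-1 : ℝ) ^ (N + 1) *
      (Real.sin x - ∑ n ∈ range (N + 1), (-1 : ℝ) ^ n * x ^ (2 * n + 1) / ((2 * n + 1).factorial : ℝ)) :=
  sinTaylor_sign_of_cosTaylor_sign N (cosTaylor_sign N) x hx

/-- (A4) The degree-`11` Taylor polynomial of `sin` is a lower bound on `[0, ∞)`:
`Σ_{n<6} (−1)ⁿ x^{2n+1}/(2n+1)! ≤ sin x` for `x ≥ 0`. [folklore] -/
private theorem sinTaylor_eleven_le_sin (x : ℝ) (hx : 0 ≤ x) :
    ∑ n ∈ range 6, (-1 : ℝ) ^ n * x ^ (2 * n + 1) / ((2 * n + 1).factorial : ℝ) ≤ Real.sin x := by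
  have h := sinTaylor_sign 5 x hx
  have e : (-1 : ℝ) ^ (5 + 1) = 1 := by norm_num
  rw [e, one_mul] at h
  linarith



/-! ### §2. The unfolded identity for a real resonator and for the `λ`-family -/

/-- For REAL coefficients the Montgomery–Odlyzko bilinear form is real:
`Re 𝔪(r)(L,h) = (2/π) Σ_{n ≤ L} Σ_{k ∣ n} (Λ(k)/(√k log k))·sin((h/2)log k)·r(n/k)·r(n)`.
[cite: GoldstonTrudgianTurnageButterbaugh2023, §1 (definition of h(c))] -/
theorem re_moForm_ofReal (r : ℕ → ℝ) (L : ℕ) (h : ℝ) :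
    (moForm (fun n => ((r n : ℝ) : ℂ)) L h).re
      = 2 / π * ∑ n ∈ Icc 1 L, ∑ k ∈ n.divisors,
          (Λ k / (Real.sqrt k * Real.log k) * Real.sin (h / 2 * Real.log k)) * r (n / k) * r n := by
  have e : moForm (fun n => ((r n : ℝ) : ℂ)) L h
      = ((2 / π * ∑ n ∈ Icc 1 L, ∑ k ∈ n.divisors,
          (Λ k / (Real.sqrt k * Real.log k) * Real.sin (h / 2 * Real.log k)) * r (n / k) * r n : ℝ) : ℂ) := by
    simp only [moForm, Complex.conj_ofReal]
    push_cast
    rfl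
  rw [e, Complex.ofReal_re]

/-- The divisor swap `Σ_{n ≤ L} Σ_{k ∣ n} F(k, n) = Σ_{k ≤ L} Σ_{m ≤ L/k} F(k, km)` (a copy of the
tree's `Halasz.sum_Icc_sum_divisors_eq`, kept private to avoid its heavy import). [folklore] -/
private theorem sum_Icc_sum_divisors_eq' {M : Type*} [AddCommMonoid M] (F : ℕ → ℕ → M) (Y : ℕ) :
    ∑ n ∈ Finset.Icc 1 Y, ∑ d ∈ n.divisors, F d n =
      ∑ d ∈ Finset.Icc 1 Y, ∑ m ∈ Finset.Icc 1 (Y / d), F d (d * m) := by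
  rw [Finset.sum_sigma', Finset.sum_sigma']
  refine Finset.sum_bij' (fun x _ => ⟨x.2, x.1 / x.2⟩) (fun x _ => ⟨x.1 * x.2, x.1⟩) ?_ ?_ ?_ ?_ ?_
  · rintro ⟨n, d⟩ hx
    simp only [Finset.mem_sigma, Finset.mem_Icc, Nat.mem_divisors] at hx ⊢
    obtain ⟨⟨hn1, hnY⟩, hdn, hn0⟩ := hx
    have hd0 : 0 < d := Nat.pos_of_dvd_of_pos hdn (by omega)
    refine ⟨⟨hd0, (Nat.le_of_dvd (by omega) hdn).trans hnY⟩, ?_, Nat.div_le_div_right hnY⟩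
    exact Nat.div_pos (Nat.le_of_dvd (by omega) hdn) hd0
  · rintro ⟨d, m⟩ hx
    simp only [Finset.mem_sigma, Finset.mem_Icc, Nat.mem_divisors] at hx ⊢
    obtain ⟨⟨hd1, hdY⟩, hm1, hmY⟩ := hx
    refine ⟨⟨Nat.one_le_iff_ne_zero.mpr (Nat.mul_ne_zero (by omega) (by omega)), ?_⟩,
      Dvd.intro m rfl, Nat.mul_ne_zero (by omega) (by omega)⟩
    exact (Nat.le_div_iff_mul_le (by omega)).mp hmY |>.trans_eq' (Nat.mul_comm _ _)
  · rintro ⟨n, d⟩ hx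
    simp only [Finset.mem_sigma, Finset.mem_Icc, Nat.mem_divisors] at hx
    obtain ⟨⟨hn1, hnY⟩, hdn, hn0⟩ := hx
    simp [Nat.mul_div_cancel' hdn]
  · rintro ⟨d, m⟩ hx
    simp only [Finset.mem_sigma, Finset.mem_Icc] at hx
    obtain ⟨⟨hd1, hdY⟩, hm1, hmY⟩ := hx
    simp [Nat.mul_div_cancel_left m (by omega : 0 < d)]
  · rintro ⟨n, d⟩ hx
    simp only [Finset.mem_sigma, Finset.mem_Icc, Nat.mem_divisors] at hx
    obtain ⟨⟨hn1, hnY⟩, hdn, hn0⟩ := hx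
    simp [Nat.mul_div_cancel' hdn]

/-- `λ(m)² = 1` for `m ≠ 0` (as reals). [folklore] -/
private theorem liouville_mul_self {m : ℕ} (hm : m ≠ 0) :
    ((ArithmeticFunction.liouville m : ℤ) : ℝ) * ((ArithmeticFunction.liouville m : ℤ) : ℝ) = 1 := by
  rw [ArithmeticFunction.liouville_apply hm]
  push_cast
  rw [← pow_add, ← two_mul, pow_mul]
  norm_num

/-- The term algebra of the unfolding: with `√k·√k = k`, `√m·√m = m`, `λ(m)² = 1`,
`(Λ/(√k·log k))·s · (λ(m)w_m/√m) · (λ(k)λ(m)w_{km}/(√k√m)) = (Λλ(k)/(k log k))·s·(w_m w_{km}/m)`.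
[folklore] -/
private theorem term_algebra (Λk s lk lm wm wkm sk sm lg k m : ℝ) (hsk : sk * sk = k)
    (hsm : sm * sm = m) (hll : lm * lm = 1) (hsk0 : sk ≠ 0) (hsm0 : sm ≠ 0) :
    Λk / (sk * lg) * s * (lm * wm / sm) * (lk * lm * wkm / (sk * sm))
      = Λk * lk / (k * lg) * s * (wm * wkm / m) := by
  rcases eq_or_ne lg 0 with hlg | hlg
  · simp [hlg]
  rw [← hsk, ← hsm]
  field_simp
  linear_combination (Λk * s * lk * wm * wkm) * hll

/-- **The unfolded identity for the `λ`-family** `r(n) = λ(n) w(log n/Y)/√n`: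
`(π/2)·Re 𝔪(r)(L,h) = Σ_{k ≤ L} (Λ(k)λ(k)/(k log k))·sin((h/2) log k)·S_k`,
`S_k = Σ_{m ≤ L/k} w(log m/Y) w(log(km)/Y)/m` (`λ(m)λ(km) = λ(k)`, `√m·√(km)·√k = km`, divisor
swap). The `k = 1` term vanishes on both sides (`Λ(1) = 0`). This is Conrey–Ghosh–Gonek's form
`Σ_{nk ≤ K} a_k ā_{nk} g_c(n) Λ(n) n^{−1/2}` for the family quoted from Montgomery–Odlyzko.
[cite: MontgomeryOdlyzko1984, main theorem as quoted in BuiMilinovichNg2010 §2 p. 3] -/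
theorem re_moForm_liouville (w : ℝ → ℝ) (Y h : ℝ) (L : ℕ) :
    (moForm (fun n => ((((ArithmeticFunction.liouville n : ℤ) : ℝ) * w (Real.log n / Y)
        / Real.sqrt n : ℝ) : ℂ)) L h).re
      = 2 / π * ∑ k ∈ Icc 1 L,
          (Λ k * ((ArithmeticFunction.liouville k : ℤ) : ℝ) / (k * Real.log k))
            * Real.sin (h / 2 * Real.log k)
            * ∑ m ∈ Icc 1 (L / k), w (Real.log m / Y) * w (Real.log (k * m) / Y) / m := by
  rw [re_moForm_ofReal, sum_Icc_sum_divisors_eq']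
  congr 1
  refine Finset.sum_congr rfl fun k hk => ?_
  have hk1 : 1 ≤ k := (Finset.mem_Icc.mp hk).1
  have hkr : (0 : ℝ) < k := by exact_mod_cast hk1
  rw [Finset.mul_sum]
  refine Finset.sum_congr rfl fun m hm => ?_
  have hm1 : 1 ≤ m := (Finset.mem_Icc.mp hm).1
  have hm0 : m ≠ 0 := by omega
  have hmr : (0 : ℝ) < m := by exact_mod_cast hm1
  rw [Nat.mul_div_cancel_left m (by omega : 0 < k), ArithmeticFunction.liouville_apply_mul]
  have hskm : Real.sqrt ((k * m : ℕ) : ℝ) = Real.sqrt k * Real.sqrt m := by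
    push_cast; exact Real.sqrt_mul hkr.le _
  rw [hskm]
  push_cast
  exact term_algebra (Λ k) (Real.sin (h / 2 * Real.log k)) _ _ _ _ _ _ (Real.log k) k m
    (Real.mul_self_sqrt hkr.le) (Real.mul_self_sqrt hmr.le) (liouville_mul_self hm0)
    (Real.sqrt_pos.mpr hkr).ne' (Real.sqrt_pos.mpr hmr).ne'

/-- **The resonator norm of the `λ`-family**: `Σ_{k ≤ L}|λ(k)w(log k/Y)/√k|² = Σ_{k ≤ L} w(log k/Y)²/k`.
[cite: MontgomeryOdlyzko1984, main theorem as quoted in BuiMilinovichNg2010 §2 p. 3] -/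
theorem coeffNormSq_liouville (w : ℝ → ℝ) (Y : ℝ) (L : ℕ) :
    coeffNormSq (fun n => ((((ArithmeticFunction.liouville n : ℤ) : ℝ) * w (Real.log n / Y)
        / Real.sqrt n : ℝ) : ℂ)) L
      = ∑ k ∈ Icc 1 L, w (Real.log k / Y) ^ 2 / k := by
  unfold coeffNormSq
  refine Finset.sum_congr rfl fun k hk => ?_
  have hk1 : 1 ≤ k := (Finset.mem_Icc.mp hk).1
  have hkr : (0 : ℝ) < k := by exact_mod_cast hk1
  rw [Complex.norm_real, Real.norm_eq_abs, sq_abs, div_pow, mul_pow, Real.sq_sqrt hkr.le,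
    show ((ArithmeticFunction.liouville k : ℤ) : ℝ) ^ 2 = 1 from by
      rw [sq]; exact liouville_mul_self (by omega), one_mul]


/-! ### §3. Weighted log-moments, and (H1)/(H2) for the quadratic weight `w(u) = 1 + (9/20)u(1−u)` -/

/-- Weighted log-moments with `O(1)` error: if `Σ_{i<N}|κ_i| ≤ B`, `0 < Y`, `1 ≤ x`, `log x ≤ Y`,
then `|Σ_{i<N} (κ_i/Y^i)·Σ_{m ≤ x}(log m)^i/m − Σ_{i<N} (κ_i/Y^i)(log x)^{i+1}/(i+1)| ≤ 2B`
((A1) term by term, `(log x)^i ≤ Y^i`). [cite: Apostol1976, Thm 3.2(a) with Thm 4.2] -/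
theorem abs_weighted_logMoments_sub_le (κ : ℕ → ℝ) (N : ℕ) {B Y x : ℝ}
    (hB : ∑ i ∈ range N, |κ i| ≤ B) (hY : 0 < Y) (hx : 1 ≤ x) (hxY : Real.log x ≤ Y) :
    |∑ i ∈ range N, κ i / Y ^ i * ∑ m ∈ Icc 1 ⌊x⌋₊, Real.log m ^ i / m
        - ∑ i ∈ range N, κ i / Y ^ i * (Real.log x ^ (i + 1) / (i + 1))| ≤ 2 * B := by
  have hX0 : 0 ≤ Real.log x := Real.log_nonneg hx
  rw [← Finset.sum_sub_distrib]
  calc |∑ i ∈ range N, (κ i / Y ^ i * ∑ m ∈ Icc 1 ⌊x⌋₊, Real.log m ^ i / m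
          - κ i / Y ^ i * (Real.log x ^ (i + 1) / (i + 1)))|
      ≤ ∑ i ∈ range N, |κ i / Y ^ i * ∑ m ∈ Icc 1 ⌊x⌋₊, Real.log m ^ i / m
          - κ i / Y ^ i * (Real.log x ^ (i + 1) / (i + 1))| := Finset.abs_sum_le_sum_abs _ _
    _ ≤ ∑ i ∈ range N, 2 * |κ i| := by
        refine Finset.sum_le_sum fun i _ => ?_
        have hYi : 0 < Y ^ i := pow_pos hY i
        rw [← mul_sub, abs_mul, abs_div, abs_of_pos hYi]
        have hA := abs_sum_log_pow_div_sub_le i hx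
        have hXY : Real.log x ^ i ≤ Y ^ i := pow_le_pow_left₀ hX0 hxY i
        calc |κ i| / Y ^ i * |∑ m ∈ Icc 1 ⌊x⌋₊, Real.log m ^ i / m - Real.log x ^ (i + 1) / (i + 1)|
            ≤ |κ i| / Y ^ i * (2 * Y ^ i) := by
              refine mul_le_mul_of_nonneg_left (hA.trans ?_) (by positivity)
              linarith
          _ = 2 * |κ i| := by field_simp
    _ = 2 * ∑ i ∈ range N, |κ i| := by rw [Finset.mul_sum]
    _ ≤ 2 * B := by linarith

/-- **(H1), abstract form**: if `w(u)² = Σ_{i<5} e_i u^i` then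
`Σ_{k ≤ y} w(log k/log y)²/k ≤ (Σ_i e_i/(i+1))·log y + 2Σ_i|e_i|` for `y > 1`.
[cite: Apostol1976, Thm 3.2(a) with Thm 4.2] -/
theorem normSum_le_of_sq_expansion (w : ℝ → ℝ) (e : ℕ → ℝ) {I B y : ℝ}
    (he : ∀ u, w u ^ 2 = ∑ i ∈ range 5, e i * u ^ i)
    (hI : ∑ i ∈ range 5, e i / (i + 1) = I) (hB : ∑ i ∈ range 5, |e i| ≤ B) (hy : 1 < y) :
    ∑ k ∈ Icc 1 ⌊y⌋₊, w (Real.log k / Real.log y) ^ 2 / k ≤ I * Real.log y + 2 * B := by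
  have hY : 0 < Real.log y := Real.log_pos hy
  -- expand the square and exchange the sums
  have hexp : ∑ k ∈ Icc 1 ⌊y⌋₊, w (Real.log k / Real.log y) ^ 2 / k
      = ∑ i ∈ range 5, e i / Real.log y ^ i * ∑ k ∈ Icc 1 ⌊y⌋₊, Real.log k ^ i / k := by
    simp_rw [Finset.mul_sum]
    rw [Finset.sum_comm]
    refine Finset.sum_congr rfl fun k _ => ?_
    rw [he, Finset.sum_div]
    refine Finset.sum_congr rfl fun i _ => ?_
    rw [div_pow]
    ring
  have hmain : ∑ i ∈ range 5, e i / Real.log y ^ i * (Real.log y ^ (i + 1) / (i + 1))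
      = I * Real.log y := by
    have : ∀ i ∈ range 5, e i / Real.log y ^ i * (Real.log y ^ (i + 1) / (i + 1))
        = Real.log y * (e i / (i + 1)) := by
      intro i _
      have hYi : Real.log y ^ i ≠ 0 := pow_ne_zero i hY.ne'
      rw [pow_succ]
      field_simp
    rw [Finset.sum_congr rfl this, ← Finset.mul_sum, hI, mul_comm]
  have herr := abs_weighted_logMoments_sub_le e 5 hB hY hy.le le_rfl
  rw [hmain] at herr
  rw [hexp]
  have := (abs_le.mp herr).2
  linarith

/-- **(H2), abstract form**: for a prime `p ≤ y` (`y > 1`), `v = log p/log y`, if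
`w(u)w(u+v) = Σ_{i<5} c_i u^i`, then
`S_p = Σ_{m ≤ y/p} w(log m/log y)w(log(pm)/log y)/m ≥ (Σ_i c_i(1−v)^{i+1}/(i+1))·log y − 2Σ|c_i|`.
[cite: Apostol1976, Thm 3.2(a) with Thm 4.2] -/
theorem shiftSum_ge_of_expansion (w : ℝ → ℝ) (c : ℕ → ℝ) {F B y : ℝ} (hy : 1 < y) {p : ℕ}
    (hp : p ∈ Nat.primesLE ⌊y⌋₊)
    (hc : ∀ u, w u * w (u + Real.log p / Real.log y) = ∑ i ∈ range 5, c i * u ^ i)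
    (hF : ∑ i ∈ range 5, c i * (1 - Real.log p / Real.log y) ^ (i + 1) / (i + 1) = F)
    (hB : ∑ i ∈ range 5, |c i| ≤ B) :
    F * Real.log y - 2 * B
      ≤ ∑ m ∈ Icc 1 (⌊y⌋₊ / p), w (Real.log m / Real.log y) * w (Real.log (p * m) / Real.log y) / m := by
  have hY : 0 < Real.log y := Real.log_pos hy
  obtain ⟨hpL, hpp⟩ := Nat.mem_primesLE.mp hp
  have hpr : (0 : ℝ) < p := by exact_mod_cast hpp.pos
  have hy0 : 0 < y := by linarith
  have hpy : (p : ℝ) ≤ y := (show (p : ℝ) ≤ ⌊y⌋₊ by exact_mod_cast hpL).trans (Nat.floor_le hy0.le)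
  have hlogp0 : 0 ≤ Real.log p := Real.log_nonneg (by exact_mod_cast hpp.one_lt.le)
  have hlogp : Real.log p ≤ Real.log y := Real.log_le_log hpr hpy
  -- `x = y/p ≥ 1`, `log x = log y - log p ≤ log y`
  have hx : 1 ≤ y / p := (one_le_div hpr).mpr hpy
  have hlogx : Real.log (y / p) = Real.log y * (1 - Real.log p / Real.log y) := by
    rw [Real.log_div hy0.ne' hpr.ne']
    field_simp
  have hlogxY : Real.log (y / p) ≤ Real.log y := by
    rw [Real.log_div hy0.ne' hpr.ne']; linarith
  have hfl : ⌊y⌋₊ / p = ⌊y / p⌋₊ := (Nat.floor_div_natCast y p).symm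
  -- expand the shifted product and exchange the sums
  have hexp : ∑ m ∈ Icc 1 (⌊y⌋₊ / p), w (Real.log m / Real.log y) * w (Real.log (p * m) / Real.log y) / m
      = ∑ i ∈ range 5, c i / Real.log y ^ i * ∑ m ∈ Icc 1 ⌊y / p⌋₊, Real.log m ^ i / m := by
    rw [hfl]
    simp_rw [Finset.mul_sum]
    rw [Finset.sum_comm]
    refine Finset.sum_congr rfl fun m hm => ?_
    have hm1 : 1 ≤ m := (Finset.mem_Icc.mp hm).1
    have hmr : (0 : ℝ) < m := by exact_mod_cast hm1
    have hsplit : Real.log ((p : ℝ) * m) / Real.log y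
        = Real.log m / Real.log y + Real.log p / Real.log y := by
      rw [Real.log_mul hpr.ne' hmr.ne']
      ring
    rw [hsplit, hc, Finset.sum_div]
    refine Finset.sum_congr rfl fun i _ => ?_
    rw [div_pow]
    ring
  -- the main term is `log y · F`
  have hmain : ∑ i ∈ range 5, c i / Real.log y ^ i * (Real.log (y / p) ^ (i + 1) / (i + 1))
      = F * Real.log y := by
    have : ∀ i ∈ range 5, c i / Real.log y ^ i * (Real.log (y / p) ^ (i + 1) / (i + 1))
        = Real.log y * (c i * (1 - Real.log p / Real.log y) ^ (i + 1) / (i + 1)) := by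
      intro i _
      have hYi : Real.log y ^ i ≠ 0 := pow_ne_zero i hY.ne'
      rw [hlogx, mul_pow, pow_succ]
      field_simp
    rw [Finset.sum_congr rfl this, ← Finset.mul_sum, hF, mul_comm]
  have herr := abs_weighted_logMoments_sub_le c 5 hB hY hx hlogxY
  rw [hmain] at herr
  rw [hexp]
  have := (abs_le.mp herr).1
  linarith

/-- `|α + βv + γv²| ≤ |α| + |β| + |γ|` for `v ∈ [0,1]`. [folklore] -/
private theorem abs_quad_le (α β γ : ℝ) {v : ℝ} (hv0 : 0 ≤ v) (hv1 : v ≤ 1) :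
    |α + β * v + γ * v ^ 2| ≤ |α| + |β| + |γ| := by
  have h1 : |β * v| ≤ |β| := by
    rw [abs_mul, abs_of_nonneg hv0]; exact mul_le_of_le_one_right (abs_nonneg _) hv1
  have hv2 : v ^ 2 ≤ 1 := by nlinarith
  have h2 : |γ * v ^ 2| ≤ |γ| := by
    rw [abs_mul, abs_of_nonneg (sq_nonneg v)]
    exact mul_le_of_le_one_right (abs_nonneg γ) hv2
  calc |α + β * v + γ * v ^ 2| ≤ |α + β * v| + |γ * v ^ 2| := abs_add_le _ _
    _ ≤ |α| + |β * v| + |γ * v ^ 2| := by linarith [abs_add_le α (β * v)]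
    _ ≤ |α| + |β| + |γ| := by linarith

/-- **(H1) for the quadratic weight**: `Σ_{k ≤ y} w(log k/log y)²/k ≤ (4627/4000) log y + 7` for
`y > 1` (`w² = 1 + (9/10)u − (279/400)u² − (81/200)u³ + (81/400)u⁴`, `I₂ = ∫₀¹ w² = 4627/4000`,
`2Σ|e_i| = 6.41 ≤ 7`). [cite: Apostol1976, Thm 3.2(a) with Thm 4.2] -/
theorem normSum_quadWeight_le (w : ℝ → ℝ) (hw : ∀ u, w u = 1 + 9 / 20 * u * (1 - u))
    {y : ℝ} (hy : 1 < y) :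
    ∑ k ∈ Icc 1 ⌊y⌋₊, w (Real.log k / Real.log y) ^ 2 / k ≤ 4627 / 4000 * Real.log y + 7 := by
  have h := normSum_le_of_sq_expansion w
    (fun i : ℕ => ([(1 : ℝ), 9 / 10, -279 / 400, -81 / 200, 81 / 400].getD i 0))
    (I := 4627 / 4000) (B := 641 / 200) (y := y) ?_ ?_ ?_ hy
  · linarith
  · intro u
    rw [hw]
    simp only [Finset.sum_range_succ, Finset.sum_range_zero, List.getD_cons_zero,
      List.getD_cons_succ]
    ring
  · simp only [Finset.sum_range_succ, Finset.sum_range_zero, List.getD_cons_zero,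
      List.getD_cons_succ]
    norm_num
  · simp only [Finset.sum_range_succ, Finset.sum_range_zero, List.getD_cons_zero,
      List.getD_cons_succ]
    norm_num

/-- **(H2) for the quadratic weight**: for `y > 1` and every prime `p ≤ y`, with `v = log p/log y`,
`S_p ≥ F(v)·log y − 13`, `S_p = Σ_{m ≤ y/p} w(log m/log y)w(log(pm)/log y)/m`,
`F(v) = ∫₀^{1−v} w(u)w(u+v)du = 4627/4000 − v − (387/800)v² + (267/800)v³ − (27/4000)v⁵`
(`w(u)w(u+v) = Σ_{i<5} c_i(v)u^i`, `2·sup Σ_i|c_i(v)| ≤ 2·311/50 ≤ 13`).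
[cite: Apostol1976, Thm 3.2(a) with Thm 4.2] -/
theorem shiftSum_quadWeight_ge (w : ℝ → ℝ) (hw : ∀ u, w u = 1 + 9 / 20 * u * (1 - u))
    {y : ℝ} (hy : 1 < y) {p : ℕ} (hp : p ∈ Nat.primesLE ⌊y⌋₊) :
    (4627 / 4000 - Real.log p / Real.log y - 387 / 800 * (Real.log p / Real.log y) ^ 2
        + 267 / 800 * (Real.log p / Real.log y) ^ 3 - 27 / 4000 * (Real.log p / Real.log y) ^ 5)
        * Real.log y - 13
      ≤ ∑ m ∈ Icc 1 (⌊y⌋₊ / p), w (Real.log m / Real.log y) * w (Real.log (p * m) / Real.log y) / m := by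
  have hY : 0 < Real.log y := Real.log_pos hy
  obtain ⟨hpL, hpp⟩ := Nat.mem_primesLE.mp hp
  have hpr : (0 : ℝ) < p := by exact_mod_cast hpp.pos
  have hy0 : 0 < y := by linarith
  have hpy : (p : ℝ) ≤ y := (show (p : ℝ) ≤ ⌊y⌋₊ by exact_mod_cast hpL).trans (Nat.floor_le hy0.le)
  set v := Real.log p / Real.log y with hv
  have hv0 : 0 ≤ v := div_nonneg (Real.log_nonneg (by exact_mod_cast hpp.one_lt.le)) hY.le
  have hv1 : v ≤ 1 := (div_le_one hY).mpr (Real.log_le_log hpr hpy)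
  have h := shiftSum_ge_of_expansion w
    (fun i : ℕ => ([1 + 9 / 20 * v - 9 / 20 * v ^ 2, 9 / 10 - 279 / 400 * v - 81 / 400 * v ^ 2,
        -279 / 400 - 243 / 400 * v + 81 / 400 * v ^ 2, -81 / 200 + 81 / 200 * v,
        (81 : ℝ) / 400].getD i 0))
    (F := 4627 / 4000 - v - 387 / 800 * v ^ 2 + 267 / 800 * v ^ 3 - 27 / 4000 * v ^ 5)
    (B := 311 / 50) hy hp ?_ ?_ ?_
  · linarith
  · intro u
    rw [hw, hw]
    simp only [Finset.sum_range_succ, Finset.sum_range_zero, List.getD_cons_zero,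
      List.getD_cons_succ]
    ring
  · simp only [Finset.sum_range_succ, Finset.sum_range_zero, List.getD_cons_zero,
      List.getD_cons_succ]
    push_cast
    ring
  · simp only [Finset.sum_range_succ, Finset.sum_range_zero, List.getD_cons_zero,
      List.getD_cons_succ]
    have h0 : |1 + 9 / 20 * v - 9 / 20 * v ^ 2| ≤ 19 / 10 := by
      have h' := abs_quad_le 1 (9 / 20) (-(9 / 20)) hv0 hv1
      have e : (1 : ℝ) + 9 / 20 * v + -(9 / 20) * v ^ 2 = 1 + 9 / 20 * v - 9 / 20 * v ^ 2 := by ring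
      rw [e] at h'
      refine h'.trans ?_
      norm_num
    have h1 : |9 / 10 - 279 / 400 * v - 81 / 400 * v ^ 2| ≤ 9 / 5 := by
      have h' := abs_quad_le (9 / 10) (-(279 / 400)) (-(81 / 400)) hv0 hv1
      have e : (9 : ℝ) / 10 + -(279 / 400) * v + -(81 / 400) * v ^ 2
          = 9 / 10 - 279 / 400 * v - 81 / 400 * v ^ 2 := by ring
      rw [e] at h'
      refine h'.trans ?_
      norm_num
    have h2 : |-279 / 400 - 243 / 400 * v + 81 / 400 * v ^ 2| ≤ 603 / 400 := by
      have h' := abs_quad_le (-279 / 400) (-(243 / 400)) (81 / 400) hv0 hv1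
      have e : (-279 : ℝ) / 400 + -(243 / 400) * v + 81 / 400 * v ^ 2
          = -279 / 400 - 243 / 400 * v + 81 / 400 * v ^ 2 := by ring
      rw [e] at h'
      refine h'.trans ?_
      norm_num
    have h3 : |-81 / 200 + 81 / 200 * v| ≤ 81 / 100 := by
      have h' := abs_quad_le (-81 / 200) (81 / 200) 0 hv0 hv1
      have e : (-81 : ℝ) / 200 + 81 / 200 * v + 0 * v ^ 2 = -81 / 200 + 81 / 200 * v := by ring
      rw [e] at h'
      refine h'.trans ?_
      norm_num
    have h4 : |(81 : ℝ) / 400| = 81 / 400 := abs_of_pos (by norm_num)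
    linarith

/-- The profile `F(v) = (1 − v)·(4627 + 627v − 1308v² + 27v³ + 27v⁴)/4000` of the quadratic weight
is non-negative on `[0,1]`. [folklore] -/
private theorem profile_quadWeight_nonneg {v : ℝ} (hv0 : 0 ≤ v) (hv1 : v ≤ 1) :
    0 ≤ 4627 / 4000 - v - 387 / 800 * v ^ 2 + 267 / 800 * v ^ 3 - 27 / 4000 * v ^ 5 := by
  have e : (4627 : ℝ) / 4000 - v - 387 / 800 * v ^ 2 + 267 / 800 * v ^ 3 - 27 / 4000 * v ^ 5
      = (1 - v) * ((4627 + 627 * v - 1308 * v ^ 2 + 27 * v ^ 3 + 27 * v ^ 4) / 4000) := by ring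
  rw [e]
  apply mul_nonneg (by linarith)
  have : v ^ 2 ≤ 1 := by nlinarith
  have h3 : 0 ≤ v ^ 3 := by positivity
  have h4 : 0 ≤ v ^ 4 := by positivity
  nlinarith

/-! ### §4. The one-sided engine: `h(c) ≥ c + (2/π)(ρ/I₂ − ε)` for `log y` large

Throughout, `y > 1`, `Y = log y`, `L = ⌊y⌋`, the resonator is `r(n) = λ(n)w(log n/Y)/√n` with
`0 ≤ w ≤ M` on `[0,1]`, and `S_k = Σ_{m ≤ L/k} w(log m/Y)w(log(km)/Y)/m`. -/

/-- The unfolded identity at the window `h = 2a/log y`: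
`Re 𝔪 = (2/π)Σ_{k ≤ y} (Λ(k)λ(k)/(k log k))·sin(a·log k/log y)·S_k`.
[cite: MontgomeryOdlyzko1984, main theorem as quoted in BuiMilinovichNg2010 §2 p. 3] -/
theorem re_moForm_liouville_window (w : ℝ → ℝ) (a y : ℝ) :
    (moForm (fun n => ((((ArithmeticFunction.liouville n : ℤ) : ℝ) * w (Real.log n / Real.log y)
        / Real.sqrt n : ℝ) : ℂ)) ⌊y⌋₊ (2 * a / Real.log y)).re
      = 2 / π * ∑ k ∈ Icc 1 ⌊y⌋₊,
          (Λ k * ((ArithmeticFunction.liouville k : ℤ) : ℝ) / (k * Real.log k))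
            * Real.sin (a * (Real.log k / Real.log y))
            * ∑ m ∈ Icc 1 (⌊y⌋₊ / k), w (Real.log m / Real.log y)
                * w (Real.log (k * m) / Real.log y) / m := by
  rw [re_moForm_liouville]
  congr 1
  refine Finset.sum_congr rfl fun k _ => ?_
  congr 2
  ring_nf

/-- Range of the weight arguments: for `1 ≤ k`, `m ≤ ⌊y⌋/k`, `1 ≤ m`, `y > 1`, both `log m/log y`
and `log(km)/log y` lie in `[0, 1]`. [folklore] -/
private theorem weightArgs_mem_Icc {y : ℝ} (hy : 1 < y) {k m : ℕ} (hk : 1 ≤ k) (hm1 : 1 ≤ m)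
    (hm : m ≤ ⌊y⌋₊ / k) :
    Real.log m / Real.log y ∈ Set.Icc (0 : ℝ) 1 ∧
      Real.log ((k : ℝ) * m) / Real.log y ∈ Set.Icc (0 : ℝ) 1 := by
  have hY : 0 < Real.log y := Real.log_pos hy
  have hy0 : 0 < y := by linarith
  have hkm : m * k ≤ ⌊y⌋₊ := (Nat.le_div_iff_mul_le (by omega)).mp hm
  have hmr : (1 : ℝ) ≤ m := by exact_mod_cast hm1
  have hkr : (1 : ℝ) ≤ k := by exact_mod_cast hk
  have hkm_y : (k : ℝ) * m ≤ y := by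
    have : ((m * k : ℕ) : ℝ) ≤ ⌊y⌋₊ := by exact_mod_cast hkm
    push_cast at this
    linarith [Nat.floor_le hy0.le, mul_comm (k : ℝ) m]
  have hlogm0 : 0 ≤ Real.log m := Real.log_nonneg hmr
  have hm_le : (m : ℝ) ≤ k * m := le_mul_of_one_le_left (by linarith) hkr
  have hlogkm : Real.log m ≤ Real.log ((k : ℝ) * m) := Real.log_le_log (by linarith) hm_le
  have hlogkm_y : Real.log ((k : ℝ) * m) ≤ Real.log y := Real.log_le_log (by nlinarith) hkm_y
  refine ⟨⟨div_nonneg hlogm0 hY.le, (div_le_one hY).mpr (hlogkm.trans hlogkm_y)⟩,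
    ⟨div_nonneg (hlogm0.trans hlogkm) hY.le, (div_le_one hY).mpr hlogkm_y⟩⟩

/-- (E1) `0 ≤ S_k ≤ M²(1 + log y)` for `1 ≤ k ≤ ⌊y⌋` when `0 ≤ w ≤ M` on `[0,1]`
(harmonic bound `Σ_{m ≤ L} 1/m ≤ 1 + log L`). [cite: Apostol1976, Thm 3.2(a)] -/
theorem shiftSum_bounds (w : ℝ → ℝ) {M y : ℝ} (hy : 1 < y)
    (hw0 : ∀ u ∈ Set.Icc (0 : ℝ) 1, 0 ≤ w u) (hwM : ∀ u ∈ Set.Icc (0 : ℝ) 1, w u ≤ M)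
    {k : ℕ} (hk : 1 ≤ k) :
    0 ≤ ∑ m ∈ Icc 1 (⌊y⌋₊ / k), w (Real.log m / Real.log y) * w (Real.log (k * m) / Real.log y) / m ∧
      ∑ m ∈ Icc 1 (⌊y⌋₊ / k), w (Real.log m / Real.log y) * w (Real.log (k * m) / Real.log y) / m
        ≤ M * M * (1 + Real.log y) := by
  have hy0 : 0 < y := by linarith
  have hL1 : 1 ≤ ⌊y⌋₊ := Nat.le_floor (by simpa using hy.le)
  have hM : 0 ≤ M := (hw0 0 ⟨le_rfl, zero_le_one⟩).trans (hwM 0 ⟨le_rfl, zero_le_one⟩)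
  have hterm : ∀ m ∈ Finset.Icc 1 (⌊y⌋₊ / k),
      0 ≤ w (Real.log m / Real.log y) * w (Real.log (k * m) / Real.log y) / m ∧
      w (Real.log m / Real.log y) * w (Real.log (k * m) / Real.log y) / m ≤ M * M * ((1 : ℝ) / m) := by
    intro m hm
    obtain ⟨hm1, hmL⟩ := Finset.mem_Icc.mp hm
    obtain ⟨hu, huv⟩ := weightArgs_mem_Icc hy hk hm1 hmL
    have hmr : (0 : ℝ) < m := by exact_mod_cast hm1
    have h0 := hw0 _ hu; have h0' := hw0 _ huv
    have hM1 := hwM _ hu; have hM1' := hwM _ huv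
    refine ⟨by positivity, ?_⟩
    rw [mul_one_div]
    exact div_le_div_of_nonneg_right (mul_le_mul hM1 hM1' h0' hM) hmr.le
  refine ⟨Finset.sum_nonneg fun m hm => (hterm m hm).1, ?_⟩
  calc ∑ m ∈ Icc 1 (⌊y⌋₊ / k), w (Real.log m / Real.log y) * w (Real.log (k * m) / Real.log y) / m
      ≤ ∑ m ∈ Icc 1 (⌊y⌋₊ / k), M * M * ((1 : ℝ) / m) := Finset.sum_le_sum fun m hm => (hterm m hm).2
    _ = M * M * ∑ m ∈ Icc 1 (⌊y⌋₊ / k), (1 : ℝ) / m := by rw [Finset.mul_sum]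
    _ ≤ M * M * ∑ m ∈ Icc 1 ⌊y⌋₊, (1 : ℝ) / m := by
        refine mul_le_mul_of_nonneg_left ?_ (by positivity)
        exact Finset.sum_le_sum_of_subset_of_nonneg
          (Finset.Icc_subset_Icc_right (Nat.div_le_self _ _)) fun m _ _ => by positivity
    _ ≤ M * M * (1 + Real.log ⌊y⌋₊) :=
        mul_le_mul_of_nonneg_left (Sieve.sum_Icc_one_div_le_one_add_log _) (by positivity)
    _ ≤ M * M * (1 + Real.log y) := by
        have : Real.log (⌊y⌋₊ : ℝ) ≤ Real.log y :=
          Real.log_le_log (by exact_mod_cast hL1) (Nat.floor_le hy0.le)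
        nlinarith

/-- `|λ(k)| ≤ 1` (as a real). [folklore] -/
private theorem abs_liouville_le_one (k : ℕ) :
    |((ArithmeticFunction.liouville k : ℤ) : ℝ)| ≤ 1 := by
  rcases eq_or_ne k 0 with rfl | hk
  · simp
  · have h := liouville_mul_self hk
    have : |((ArithmeticFunction.liouville k : ℤ) : ℝ)| * |((ArithmeticFunction.liouville k : ℤ) : ℝ)| = 1 := by
      rw [abs_mul_abs_self]; exact h
    nlinarith [abs_nonneg (((ArithmeticFunction.liouville k : ℤ) : ℝ))]

/-- The weight of each `k`: `|Λ(k)λ(k)/(k log k) · sin(a log k/log y)| ≤ (a/log y)·Λ(k)/k` for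
`k ≥ 1`, `a ≥ 0`, `y > 1` (`|sin x| ≤ |x|`; the `k = 1` term is `0 ≤ 0`). [folklore] -/
private theorem abs_weightK_le {a y : ℝ} (ha : 0 ≤ a) (hy : 1 < y) {k : ℕ} (hk : 1 ≤ k) :
    |Λ k * ((ArithmeticFunction.liouville k : ℤ) : ℝ) / (k * Real.log k)
        * Real.sin (a * (Real.log k / Real.log y))| ≤ a / Real.log y * (Λ k / k) := by
  have hY : 0 < Real.log y := Real.log_pos hy
  have hkr : (0 : ℝ) < k := by exact_mod_cast hk
  have hΛ : 0 ≤ Λ k := ArithmeticFunction.vonMangoldt_nonneg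
  rcases eq_or_lt_of_le (Real.log_nonneg (show (1 : ℝ) ≤ k by exact_mod_cast hk)) with hlog | hlog
  · -- `log k = 0`, i.e. `k = 1`: both sides vanish or are `≥ 0`
    rw [← hlog]
    simp only [mul_zero, div_zero, zero_mul, abs_zero, zero_div]
    positivity
  have hsin : |Real.sin (a * (Real.log k / Real.log y))| ≤ a * (Real.log k / Real.log y) := by
    refine Real.abs_sin_le_abs.trans (le_of_eq (abs_of_nonneg (by positivity)))
  rw [abs_mul, abs_div, abs_mul, abs_of_nonneg hΛ, abs_mul, abs_of_pos hkr, abs_of_pos hlog]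
  calc Λ k * |((ArithmeticFunction.liouville k : ℤ) : ℝ)| / (k * Real.log k)
        * |Real.sin (a * (Real.log k / Real.log y))|
      ≤ Λ k * 1 / (k * Real.log k) * (a * (Real.log k / Real.log y)) := by
        gcongr
        · exact abs_liouville_le_one k
    _ = a / Real.log y * (Λ k / k) := by field_simp

/-- (E2) The non-prime `k` contribute `O(1)`:
`|Σ_{k ≤ y, k ∉ ℙ} (Λ(k)λ(k)/(k log k))·sin(a log k/log y)·S_k| ≤ (a/log y)·M²(1 + log y)·(39/50 + 4)`.
[cite: Apostol1976, Thm 4.9–4.10 (proof of Thm 4.10)] -/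
theorem abs_nonprimeSum_le (w : ℝ → ℝ) {M a y : ℝ} (ha : 0 ≤ a) (hy : 1 < y)
    (hw0 : ∀ u ∈ Set.Icc (0 : ℝ) 1, 0 ≤ w u) (hwM : ∀ u ∈ Set.Icc (0 : ℝ) 1, w u ≤ M) :
    |∑ k ∈ (Finset.Icc 1 ⌊y⌋₊).filter (fun k => ¬ k.Prime),
        (Λ k * ((ArithmeticFunction.liouville k : ℤ) : ℝ) / (k * Real.log k))
          * Real.sin (a * (Real.log k / Real.log y))
          * ∑ m ∈ Icc 1 (⌊y⌋₊ / k), w (Real.log m / Real.log y)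
              * w (Real.log (k * m) / Real.log y) / m|
      ≤ a / Real.log y * (M * M * (1 + Real.log y)) * (39 / 50 + 4) := by
  have hY : 0 < Real.log y := Real.log_pos hy
  have hM : 0 ≤ M := (hw0 0 ⟨le_rfl, zero_le_one⟩).trans (hwM 0 ⟨le_rfl, zero_le_one⟩)
  have hA3 := sum_vonMangoldt_div_not_prime_le hy.le
  refine (Finset.abs_sum_le_sum_abs _ _).trans ?_
  calc ∑ k ∈ (Finset.Icc 1 ⌊y⌋₊).filter (fun k => ¬ k.Prime),
        |(Λ k * ((ArithmeticFunction.liouville k : ℤ) : ℝ) / (k * Real.log k))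
          * Real.sin (a * (Real.log k / Real.log y))
          * ∑ m ∈ Icc 1 (⌊y⌋₊ / k), w (Real.log m / Real.log y)
              * w (Real.log (k * m) / Real.log y) / m|
      ≤ ∑ k ∈ (Finset.Icc 1 ⌊y⌋₊).filter (fun k => ¬ k.Prime),
          a / Real.log y * (Λ k / k) * (M * M * (1 + Real.log y)) := by
        refine Finset.sum_le_sum fun k hk => ?_
        have hk1 : 1 ≤ k := (Finset.mem_Icc.mp (Finset.mem_filter.mp hk).1).1
        obtain ⟨hS0, hSM⟩ := shiftSum_bounds w hy hw0 hwM hk1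
        rw [abs_mul, abs_of_nonneg hS0]
        exact mul_le_mul (abs_weightK_le ha hy hk1) hSM hS0 (by positivity)
    _ = a / Real.log y * (M * M * (1 + Real.log y))
          * ∑ k ∈ (Finset.Icc 1 ⌊y⌋₊).filter (fun k => ¬ k.Prime), Λ k / k := by
        rw [Finset.mul_sum]
        refine Finset.sum_congr rfl fun k _ => ?_
        ring
    _ ≤ a / Real.log y * (M * M * (1 + Real.log y)) * (39 / 50 + 4) :=
        mul_le_mul_of_nonneg_left hA3 (by positivity)

/-- The primes in `[1, n]`. [folklore] -/
private theorem filter_prime_Icc_eq_primesLE (n : ℕ) :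
    (Finset.Icc 1 n).filter (fun k => k.Prime) = Nat.primesLE n := by
  ext k
  rw [Finset.mem_filter, Finset.mem_Icc, Nat.mem_primesLE]
  constructor
  · rintro ⟨⟨-, hk⟩, hp⟩; exact ⟨hk, hp⟩
  · rintro ⟨hk, hp⟩; exact ⟨⟨hp.one_lt.le, hk⟩, hp⟩

/-- (E3) On primes the weight is `Λ(p)λ(p)/(p log p) = −1/p`, so the prime part of the unfolded
sum is `−Σ_{p ≤ y} sin(a log p/log y)·S_p/p`. [cite: MontgomeryOdlyzko1984, main theorem as quoted in BuiMilinovichNg2010 §2 p. 3] -/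
theorem primeSum_eq (w : ℝ → ℝ) (a y : ℝ) :
    ∑ k ∈ (Finset.Icc 1 ⌊y⌋₊).filter (fun k => k.Prime),
        (Λ k * ((ArithmeticFunction.liouville k : ℤ) : ℝ) / (k * Real.log k))
          * Real.sin (a * (Real.log k / Real.log y))
          * ∑ m ∈ Icc 1 (⌊y⌋₊ / k), w (Real.log m / Real.log y)
              * w (Real.log (k * m) / Real.log y) / m
      = -∑ p ∈ Nat.primesLE ⌊y⌋₊,
          Real.sin (a * (Real.log p / Real.log y)) / p
            * ∑ m ∈ Icc 1 (⌊y⌋₊ / p), w (Real.log m / Real.log y)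
                * w (Real.log (p * m) / Real.log y) / m := by
  rw [filter_prime_Icc_eq_primesLE, ← Finset.sum_neg_distrib]
  refine Finset.sum_congr rfl fun p hp => ?_
  have hpp := (Nat.mem_primesLE.mp hp).2
  have hpr : (0 : ℝ) < p := by exact_mod_cast hpp.pos
  have hlog : Real.log p ≠ 0 := (Real.log_pos (by exact_mod_cast hpp.one_lt)).ne'
  rw [ArithmeticFunction.vonMangoldt_apply_prime hpp, ArithmeticFunction.liouville_apply hpp.ne_zero,
    ArithmeticFunction.cardFactors_apply_prime hpp]
  push_cast
  field_simp

/-- `Σ_{p ≤ y} sin(a log p/log y)/p ≤ (a/log y)(log y + 2)` for `a ≥ 0`, `y > 1`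
(`sin x ≤ x` and the tree's `Σ_{p ≤ y} log p/p ≤ log y + 2`). [cite: HardyWright2008, Thm 425 (§22.6)] -/
theorem primeSum_sin_div_le {a y : ℝ} (ha : 0 ≤ a) (hy : 1 < y) :
    ∑ p ∈ Nat.primesLE ⌊y⌋₊, Real.sin (a * (Real.log p / Real.log y)) / p
      ≤ a / Real.log y * (Real.log y + 2) := by
  have hY : 0 < Real.log y := Real.log_pos hy
  have hM := (Literature.NumberTheory.LFunctions.MertensBound.sum_log_div_prime_bounds hy.le).2
  calc ∑ p ∈ Nat.primesLE ⌊y⌋₊, Real.sin (a * (Real.log p / Real.log y)) / p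
      ≤ ∑ p ∈ Nat.primesLE ⌊y⌋₊, a / Real.log y * (Real.log p / p) := by
        refine Finset.sum_le_sum fun p hp => ?_
        have hpp := (Nat.mem_primesLE.mp hp).2
        have hpr : (0 : ℝ) < p := by exact_mod_cast hpp.pos
        have hlp : 0 ≤ Real.log p := Real.log_nonneg (by exact_mod_cast hpp.one_lt.le)
        have hs : Real.sin (a * (Real.log p / Real.log y)) ≤ a * (Real.log p / Real.log y) :=
          Real.sin_le (by positivity)
        calc Real.sin (a * (Real.log p / Real.log y)) / p ≤ a * (Real.log p / Real.log y) / p :=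
              div_le_div_of_nonneg_right hs hpr.le
          _ = a / Real.log y * (Real.log p / p) := by field_simp
    _ = a / Real.log y * ∑ p ∈ Nat.primesLE ⌊y⌋₊, Real.log p / p := by rw [Finset.mul_sum]
    _ ≤ a / Real.log y * (Real.log y + 2) := mul_le_mul_of_nonneg_left hM (by positivity)

/-- (E4/E5) **The prime main term through the Taylor minorant.** For `0 ≤ a`, `y > 1`, and a
profile `F(v) = Σ_{j<6} F_j v^j ≥ 0` on `[0,1]`:
`Σ_{p ≤ y} sin(a·v_p)·F(v_p)/p ≥ ρ(a,F) − (8/log y)·Q(a,F)`, `v_p = log p/log y`, where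
`ρ(a,F) = Σ_{i<6}Σ_{j<6} (−1)^i a^{2i+1}/(2i+1)!·F_j/(2i+j+1)` (`= ∫₀¹ T₁₁(av)F(v)v⁻¹dv`) and
`Q(a,F) = Σ_{i,j} a^{2i+1}/(2i+1)!·|F_j|`: `sin ≥ T₁₁` on `[0,∞)` and `F ≥ 0` reduce the sum to the
monomial prime sums `Σ_p (log p/p)(log p/log y)^{2i+j}` of (A2).
[cite: MontgomeryOdlyzko1984, main theorem as quoted in BuiMilinovichNg2010 §2 p. 3] -/
theorem primeSum_sin_profile_ge (Fc : ℕ → ℝ) {a y : ℝ} (ha : 0 ≤ a) (hy : 1 < y)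
    (hF : ∀ v ∈ Set.Icc (0 : ℝ) 1, 0 ≤ ∑ j ∈ range 6, Fc j * v ^ j) :
    ∑ i ∈ range 6, ∑ j ∈ range 6,
        (-1 : ℝ) ^ i * a ^ (2 * i + 1) / ((2 * i + 1).factorial : ℝ) * Fc j / (2 * i + j + 1)
      - 8 / Real.log y * ∑ i ∈ range 6, ∑ j ∈ range 6,
          a ^ (2 * i + 1) / ((2 * i + 1).factorial : ℝ) * |Fc j|
      ≤ ∑ p ∈ Nat.primesLE ⌊y⌋₊, Real.sin (a * (Real.log p / Real.log y)) / p
          * ∑ j ∈ range 6, Fc j * (Real.log p / Real.log y) ^ j := by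
  have hY : 0 < Real.log y := Real.log_pos hy
  have hy0 : 0 < y := by linarith
  -- abbreviations: `q i j`, the monomial prime sums `P n`
  set q : ℕ → ℕ → ℝ := fun i j =>
    (-1 : ℝ) ^ i * a ^ (2 * i + 1) / ((2 * i + 1).factorial : ℝ) * Fc j with hq
  set P : ℕ → ℝ := fun n =>
    ∑ p ∈ Nat.primesLE ⌊y⌋₊, Real.log p / p * (Real.log p / Real.log y) ^ n with hP
  have habsq : ∀ i j, |q i j| = a ^ (2 * i + 1) / ((2 * i + 1).factorial : ℝ) * |Fc j| := by
    intro i j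
    simp only [hq, abs_mul, abs_div, abs_pow, abs_neg, abs_one, one_pow, one_mul, abs_of_nonneg ha,
      Nat.abs_cast]
  -- Step 1: `sin ≥ T₁₁` termwise (legitimate since `F(v_p) ≥ 0`)
  have hstep1 : ∑ p ∈ Nat.primesLE ⌊y⌋₊,
      (∑ i ∈ range 6, (-1 : ℝ) ^ i * (a * (Real.log p / Real.log y)) ^ (2 * i + 1)
          / ((2 * i + 1).factorial : ℝ)) / p
        * ∑ j ∈ range 6, Fc j * (Real.log p / Real.log y) ^ j
      ≤ ∑ p ∈ Nat.primesLE ⌊y⌋₊, Real.sin (a * (Real.log p / Real.log y)) / p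
          * ∑ j ∈ range 6, Fc j * (Real.log p / Real.log y) ^ j := by
    refine Finset.sum_le_sum fun p hp => ?_
    obtain ⟨hpL, hpp⟩ := Nat.mem_primesLE.mp hp
    have hpr : (0 : ℝ) < p := by exact_mod_cast hpp.pos
    have hpy : (p : ℝ) ≤ y := (show (p : ℝ) ≤ ⌊y⌋₊ by exact_mod_cast hpL).trans (Nat.floor_le hy0.le)
    have hv0 : 0 ≤ Real.log p / Real.log y :=
      div_nonneg (Real.log_nonneg (by exact_mod_cast hpp.one_lt.le)) hY.le
    have hv1 : Real.log p / Real.log y ≤ 1 := (div_le_one hY).mpr (Real.log_le_log hpr hpy)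
    have hFp := hF _ ⟨hv0, hv1⟩
    have hT := sinTaylor_eleven_le_sin (a * (Real.log p / Real.log y)) (by positivity)
    exact mul_le_mul_of_nonneg_right (div_le_div_of_nonneg_right hT hpr.le) hFp
  refine le_trans ?_ hstep1
  -- Step 2: the Taylor side is `Σ_{i,j} q_{ij} · P_{2i+j} / log y`
  have hstep2 : ∑ p ∈ Nat.primesLE ⌊y⌋₊,
      (∑ i ∈ range 6, (-1 : ℝ) ^ i * (a * (Real.log p / Real.log y)) ^ (2 * i + 1)
          / ((2 * i + 1).factorial : ℝ)) / p
        * ∑ j ∈ range 6, Fc j * (Real.log p / Real.log y) ^ j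
      = ∑ i ∈ range 6, ∑ j ∈ range 6, q i j / Real.log y * P (2 * i + j) := by
    -- write each `p`-term as a double sum, then move the `p`-sum inside
    have hterm : ∀ p ∈ Nat.primesLE ⌊y⌋₊,
        (∑ i ∈ range 6, (-1 : ℝ) ^ i * (a * (Real.log p / Real.log y)) ^ (2 * i + 1)
            / ((2 * i + 1).factorial : ℝ)) / p
          * ∑ j ∈ range 6, Fc j * (Real.log p / Real.log y) ^ j
        = ∑ i ∈ range 6, ∑ j ∈ range 6,
            q i j / Real.log y * (Real.log p / p * (Real.log p / Real.log y) ^ (2 * i + j)) := by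
      intro p hp
      have hpp := (Nat.mem_primesLE.mp hp).2
      have hpr : (0 : ℝ) < p := by exact_mod_cast hpp.pos
      have hpne : (p : ℝ) ≠ 0 := hpr.ne'
      have hYne : Real.log y ≠ 0 := hY.ne'
      rw [Finset.sum_div, Finset.sum_mul]
      refine Finset.sum_congr rfl fun i _ => ?_
      rw [Finset.mul_sum]
      refine Finset.sum_congr rfl fun j _ => ?_
      simp only [hq]
      have hv : (Real.log p / Real.log y) ^ (2 * i + 1) * (Real.log p / Real.log y) ^ j
          = (Real.log p / Real.log y) ^ (2 * i + j) * (Real.log p / Real.log y) := by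
        rw [← pow_add, ← pow_succ]; congr 1; omega
      calc _ = (-1 : ℝ) ^ i * a ^ (2 * i + 1) / ((2 * i + 1).factorial : ℝ) * Fc j
            * ((Real.log p / Real.log y) ^ (2 * i + 1) * (Real.log p / Real.log y) ^ j) / p := by
              rw [mul_pow]; ring
        _ = _ := by rw [hv]; ring
    rw [Finset.sum_congr rfl hterm, Finset.sum_comm]
    refine Finset.sum_congr rfl fun i _ => ?_
    rw [Finset.sum_comm]
    refine Finset.sum_congr rfl fun j _ => ?_
    rw [hP, Finset.mul_sum]
  rw [hstep2]
  -- Step 3: (A2) in each cell: `q/Y · P_n ≥ q/(n+1) − 8|q|/Y`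
  have hcell : ∀ i ∈ range 6, ∀ j ∈ range 6,
      q i j / (2 * i + j + 1) - 8 / Real.log y * |q i j| ≤ q i j / Real.log y * P (2 * i + j) := by
    intro i _ j _
    have hA := abs_sum_primesLE_logDiv_mul_pow_sub_le (2 * i + j) hy
    have hA' : |P (2 * i + j) - Real.log y / (2 * i + j + 1)| ≤ 8 := by
      simpa [hP] using hA
    have e : q i j / Real.log y * P (2 * i + j)
        = q i j / (2 * i + j + 1) + q i j / Real.log y * (P (2 * i + j) - Real.log y / (2 * i + j + 1)) := by
      field_simp
      ring
    rw [e]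
    have hb : |q i j / Real.log y * (P (2 * i + j) - Real.log y / (2 * i + j + 1))|
        ≤ 8 / Real.log y * |q i j| := by
      rw [abs_mul, abs_div, abs_of_pos hY]
      calc |q i j| / Real.log y * |P (2 * i + j) - Real.log y / (2 * i + j + 1)|
          ≤ |q i j| / Real.log y * 8 := mul_le_mul_of_nonneg_left hA' (by positivity)
        _ = 8 / Real.log y * |q i j| := by ring
    have := neg_abs_le (q i j / Real.log y * (P (2 * i + j) - Real.log y / (2 * i + j + 1)))
    linarith
  -- Step 4: sum the cells
  have hsum : ∑ i ∈ range 6, ∑ j ∈ range 6, (q i j / (2 * i + j + 1) - 8 / Real.log y * |q i j|)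
      ≤ ∑ i ∈ range 6, ∑ j ∈ range 6, q i j / Real.log y * P (2 * i + j) :=
    Finset.sum_le_sum fun i hi => Finset.sum_le_sum fun j hj => hcell i hi j hj
  have hρ' : ∑ i ∈ range 6, ∑ j ∈ range 6,
        (-1 : ℝ) ^ i * a ^ (2 * i + 1) / ((2 * i + 1).factorial : ℝ) * Fc j / (2 * i + j + 1)
      = ∑ i ∈ range 6, ∑ j ∈ range 6, q i j / (2 * i + j + 1) :=
    Finset.sum_congr rfl fun i _ => Finset.sum_congr rfl fun j _ => by simp only [hq]
  have hQ' : 8 / Real.log y * ∑ i ∈ range 6, ∑ j ∈ range 6,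
        a ^ (2 * i + 1) / ((2 * i + 1).factorial : ℝ) * |Fc j|
      = ∑ i ∈ range 6, ∑ j ∈ range 6, 8 / Real.log y * |q i j| := by
    simp_rw [Finset.mul_sum, habsq]
  have hsplit : ∑ i ∈ range 6, ∑ j ∈ range 6, (q i j / (2 * i + j + 1) - 8 / Real.log y * |q i j|)
      = (∑ i ∈ range 6, ∑ j ∈ range 6, q i j / (2 * i + j + 1))
        - ∑ i ∈ range 6, ∑ j ∈ range 6, 8 / Real.log y * |q i j| := by
    simp only [Finset.sum_sub_distrib]
  linarith [hsum, hρ', hQ', hsplit]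

set_option maxHeartbeats 400000 in
/-- (E6) **The one-sided engine.** For a weight `0 ≤ w ≤ M` on `[0,1]` with `w(0) = 1`, a profile
`F = Σ_{j<6}F_j v^j ≥ 0` on `[0,1]`, `0 < a ≤ π`, and the two asymptotic inputs
(H1) `Σ_{k ≤ y} w(log k/log y)²/k ≤ I₂ log y + C₁`, (H2) `S_p ≥ F(log p/log y) log y − C₂` (primes
`p ≤ y`), the Montgomery–Odlyzko value of the `λ`-resonator at the window `h = 2a/log y` satisfies,
for every `ε > 0` and all `y` with `log y` large,
`c − Re 𝔪/Σ|r|² ≥ c + (2/π)(ρ(a,F)/I₂ − ε)` (and `Σ|r|² > 0`).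
[cite: MontgomeryOdlyzko1984, main theorem as quoted in BuiMilinovichNg2010 §2 p. 3] -/
theorem moValue_liouville_ge (w : ℝ → ℝ) (Fc : ℕ → ℝ) {M I₂ C₁ C₂ a ε ρ Q : ℝ} (c : ℝ)
    (ha : 0 < a) (haπ : a ≤ π) (hε : 0 < ε) (hI₂ : 0 < I₂) (hC₁ : 0 ≤ C₁) (hC₂ : 0 ≤ C₂)
    (hw0 : ∀ u ∈ Set.Icc (0 : ℝ) 1, 0 ≤ w u) (hwM : ∀ u ∈ Set.Icc (0 : ℝ) 1, w u ≤ M)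
    (hw_zero : w 0 = 1)
    (hF : ∀ v ∈ Set.Icc (0 : ℝ) 1, 0 ≤ ∑ j ∈ range 6, Fc j * v ^ j)
    (hρ : ρ = ∑ i ∈ range 6, ∑ j ∈ range 6,
        (-1 : ℝ) ^ i * a ^ (2 * i + 1) / ((2 * i + 1).factorial : ℝ) * Fc j / (2 * i + j + 1))
    (hρ0 : 0 < ρ)
    (hQ : Q = ∑ i ∈ range 6, ∑ j ∈ range 6, a ^ (2 * i + 1) / ((2 * i + 1).factorial : ℝ) * |Fc j|)
    (h1 : ∀ y : ℝ, 1 < y →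
      ∑ k ∈ Icc 1 ⌊y⌋₊, w (Real.log k / Real.log y) ^ 2 / k ≤ I₂ * Real.log y + C₁)
    (h2 : ∀ y : ℝ, 1 < y → ∀ p ∈ Nat.primesLE ⌊y⌋₊,
      (∑ j ∈ range 6, Fc j * (Real.log p / Real.log y) ^ j) * Real.log y - C₂
        ≤ ∑ m ∈ Icc 1 (⌊y⌋₊ / p), w (Real.log m / Real.log y)
            * w (Real.log (p * m) / Real.log y) / m) :
    ∃ Y₁ : ℝ, ∀ y : ℝ, 1 < y → Y₁ ≤ Real.log y →
      0 < coeffNormSq (fun n => ((((ArithmeticFunction.liouville n : ℤ) : ℝ)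
            * w (Real.log n / Real.log y) / Real.sqrt n : ℝ) : ℂ)) ⌊y⌋₊ ∧
      c + 2 / π * (ρ / I₂ - ε)
        ≤ c - (moForm (fun n => ((((ArithmeticFunction.liouville n : ℤ) : ℝ)
              * w (Real.log n / Real.log y) / Real.sqrt n : ℝ) : ℂ)) ⌊y⌋₊ (2 * a / Real.log y)).re
            / coeffNormSq (fun n => ((((ArithmeticFunction.liouville n : ℤ) : ℝ)
              * w (Real.log n / Real.log y) / Real.sqrt n : ℝ) : ℂ)) ⌊y⌋₊ := by
  have hM : 0 ≤ M := (hw0 0 ⟨le_rfl, zero_le_one⟩).trans (hwM 0 ⟨le_rfl, zero_le_one⟩)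
  have hQ0 : 0 ≤ Q := by
    rw [hQ]
    exact Finset.sum_nonneg fun i _ => Finset.sum_nonneg fun j _ => by positivity
  -- the constant absorbing all `O(1)` errors (for `log y ≥ 1`)
  set C₃ : ℝ := 8 * Q + 3 * a * C₂ + 10 * a * (M * M) with hC₃
  have hC₃0 : 0 ≤ C₃ := by positivity
  refine ⟨max 1 (max (C₃ / ρ) ((C₃ + ρ * C₁ / I₂) / (ε * I₂))), fun y hy hY₁ => ?_⟩
  have hY : 0 < Real.log y := Real.log_pos hy
  have hY1 : 1 ≤ Real.log y := le_trans (le_max_left _ _) hY₁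
  have hYρ : C₃ / ρ ≤ Real.log y := le_trans ((le_max_left _ _).trans (le_max_right _ _)) hY₁
  have hYε : (C₃ + ρ * C₁ / I₂) / (ε * I₂) ≤ Real.log y :=
    le_trans ((le_max_right _ _).trans (le_max_right _ _)) hY₁
  have hL1 : 1 ≤ ⌊y⌋₊ := Nat.le_floor (by simpa using hy.le)
  -- the norm `N`
  rw [coeffNormSq_liouville, re_moForm_liouville_window]
  set N := ∑ k ∈ Icc 1 ⌊y⌋₊, w (Real.log k / Real.log y) ^ 2 / k with hN
  have hN1 : 1 ≤ N := by
    have h1mem : 1 ∈ Finset.Icc 1 ⌊y⌋₊ := Finset.mem_Icc.mpr ⟨le_rfl, hL1⟩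
    have hle := Finset.single_le_sum (f := fun k : ℕ => w (Real.log k / Real.log y) ^ 2 / k)
      (fun k _ => by positivity) h1mem
    simp only [Nat.cast_one, Real.log_one, zero_div, hw_zero, one_pow, div_one] at hle
    exact hle
  have hN0 : 0 < N := by linarith
  have hNle : N ≤ I₂ * Real.log y + C₁ := h1 y hy
  refine ⟨hN0, ?_⟩
  -- split the `k`-sum into primes and non-primes
  set T : ℕ → ℝ := fun k => (Λ k * ((ArithmeticFunction.liouville k : ℤ) : ℝ) / (k * Real.log k))
      * Real.sin (a * (Real.log k / Real.log y))
      * ∑ m ∈ Icc 1 (⌊y⌋₊ / k), w (Real.log m / Real.log y)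
          * w (Real.log (k * m) / Real.log y) / m with hT
  have hsplit : ∑ k ∈ Icc 1 ⌊y⌋₊, T k
      = (∑ k ∈ (Finset.Icc 1 ⌊y⌋₊).filter (fun k => k.Prime), T k)
        + ∑ k ∈ (Finset.Icc 1 ⌊y⌋₊).filter (fun k => ¬ k.Prime), T k :=
    (Finset.sum_filter_add_sum_filter_not _ _ _).symm
  have hprime : ∑ k ∈ (Finset.Icc 1 ⌊y⌋₊).filter (fun k => k.Prime), T k
      = -∑ p ∈ Nat.primesLE ⌊y⌋₊, Real.sin (a * (Real.log p / Real.log y)) / p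
          * ∑ m ∈ Icc 1 (⌊y⌋₊ / p), w (Real.log m / Real.log y)
              * w (Real.log (p * m) / Real.log y) / m := primeSum_eq w a y
  have hnonprime : |∑ k ∈ (Finset.Icc 1 ⌊y⌋₊).filter (fun k => ¬ k.Prime), T k|
      ≤ a / Real.log y * (M * M * (1 + Real.log y)) * (39 / 50 + 4) :=
    abs_nonprimeSum_le w ha.le hy hw0 hwM
  have hnonprime' : |∑ k ∈ (Finset.Icc 1 ⌊y⌋₊).filter (fun k => ¬ k.Prime), T k|
      ≤ 10 * a * (M * M) := by
    refine hnonprime.trans ?_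
    rw [div_mul_eq_mul_div, div_mul_eq_mul_div, div_le_iff₀ hY]
    nlinarith [mul_nonneg ha.le (mul_nonneg hM hM)]
  -- the prime main term
  have hmain : Real.log y * ρ - 8 * Q - 3 * a * C₂
      ≤ ∑ p ∈ Nat.primesLE ⌊y⌋₊, Real.sin (a * (Real.log p / Real.log y)) / p
          * ∑ m ∈ Icc 1 (⌊y⌋₊ / p), w (Real.log m / Real.log y)
              * w (Real.log (p * m) / Real.log y) / m := by
    have hsin0 : ∀ p ∈ Nat.primesLE ⌊y⌋₊, 0 ≤ Real.sin (a * (Real.log p / Real.log y)) / p := by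
      intro p hp
      obtain ⟨hpL, hpp⟩ := Nat.mem_primesLE.mp hp
      have hpr : (0 : ℝ) < p := by exact_mod_cast hpp.pos
      have hy0 : 0 < y := by linarith
      have hpy : (p : ℝ) ≤ y :=
        (show (p : ℝ) ≤ ⌊y⌋₊ by exact_mod_cast hpL).trans (Nat.floor_le hy0.le)
      have hv0 : 0 ≤ Real.log p / Real.log y :=
        div_nonneg (Real.log_nonneg (by exact_mod_cast hpp.one_lt.le)) hY.le
      have hv1 : Real.log p / Real.log y ≤ 1 := (div_le_one hY).mpr (Real.log_le_log hpr hpy)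
      refine div_nonneg (Real.sin_nonneg_of_nonneg_of_le_pi (by positivity) ?_) hpr.le
      calc a * (Real.log p / Real.log y) ≤ a * 1 := by gcongr
        _ ≤ π := by linarith
    -- lower each `S_p` by (H2)
    have hlow : ∑ p ∈ Nat.primesLE ⌊y⌋₊, Real.sin (a * (Real.log p / Real.log y)) / p
          * ((∑ j ∈ range 6, Fc j * (Real.log p / Real.log y) ^ j) * Real.log y - C₂)
        ≤ ∑ p ∈ Nat.primesLE ⌊y⌋₊, Real.sin (a * (Real.log p / Real.log y)) / p
          * ∑ m ∈ Icc 1 (⌊y⌋₊ / p), w (Real.log m / Real.log y)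
              * w (Real.log (p * m) / Real.log y) / m :=
      Finset.sum_le_sum fun p hp => mul_le_mul_of_nonneg_left (h2 y hy p hp) (hsin0 p hp)
    refine le_trans ?_ hlow
    have hE5 := primeSum_sin_profile_ge Fc ha.le hy hF
    rw [← hρ, ← hQ] at hE5
    have hE4 := primeSum_sin_div_le ha.le hy
    -- `Σ sin/p·(F·Y − C₂) = Y·Σ sin F/p − C₂ Σ sin/p`
    have e : ∑ p ∈ Nat.primesLE ⌊y⌋₊, Real.sin (a * (Real.log p / Real.log y)) / p
          * ((∑ j ∈ range 6, Fc j * (Real.log p / Real.log y) ^ j) * Real.log y - C₂)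
        = Real.log y * ∑ p ∈ Nat.primesLE ⌊y⌋₊, Real.sin (a * (Real.log p / Real.log y)) / p
            * ∑ j ∈ range 6, Fc j * (Real.log p / Real.log y) ^ j
          - C₂ * ∑ p ∈ Nat.primesLE ⌊y⌋₊, Real.sin (a * (Real.log p / Real.log y)) / p := by
      rw [Finset.mul_sum, Finset.mul_sum, ← Finset.sum_sub_distrib]
      refine Finset.sum_congr rfl fun p _ => ?_
      ring
    rw [e]
    have hb1 : Real.log y * (ρ - 8 / Real.log y * Q)
        ≤ Real.log y * ∑ p ∈ Nat.primesLE ⌊y⌋₊, Real.sin (a * (Real.log p / Real.log y)) / p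
            * ∑ j ∈ range 6, Fc j * (Real.log p / Real.log y) ^ j :=
      mul_le_mul_of_nonneg_left hE5 hY.le
    have hb2 : C₂ * ∑ p ∈ Nat.primesLE ⌊y⌋₊, Real.sin (a * (Real.log p / Real.log y)) / p
        ≤ C₂ * (a / Real.log y * (Real.log y + 2)) := mul_le_mul_of_nonneg_left hE4 hC₂
    have e1 : Real.log y * (ρ - 8 / Real.log y * Q) = Real.log y * ρ - 8 * Q := by field_simp
    have e2 : C₂ * (a / Real.log y * (Real.log y + 2)) ≤ 3 * a * C₂ := by
      rw [div_mul_eq_mul_div, mul_div_assoc', div_le_iff₀ hY]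
      nlinarith [mul_nonneg hC₂ ha.le]
    linarith
  -- assemble: `−Σ_k T k ≥ Y ρ − C₃`
  have htot : Real.log y * ρ - C₃ ≤ -∑ k ∈ Icc 1 ⌊y⌋₊, T k := by
    rw [hsplit, hprime]
    linarith [(abs_le.mp hnonprime').2, hmain]
  -- the quotient
  have hnum0 : 0 ≤ Real.log y * ρ - C₃ := by
    have := (div_le_iff₀ hρ0).mp hYρ
    linarith
  have hden : 0 < I₂ * Real.log y + C₁ := by positivity
  have hq1 : (Real.log y * ρ - C₃) / (I₂ * Real.log y + C₁) ≤ (Real.log y * ρ - C₃) / N :=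
    div_le_div_of_nonneg_left hnum0 hN0 hNle
  have hq2 : ρ / I₂ - ε ≤ (Real.log y * ρ - C₃) / (I₂ * Real.log y + C₁) := by
    rw [le_div_iff₀ hden]
    have hYε' : C₃ + ρ * C₁ / I₂ ≤ ε * I₂ * Real.log y := by
      have := (div_le_iff₀ (by positivity : 0 < ε * I₂)).mp hYε
      linarith
    have e : (ρ / I₂ - ε) * (I₂ * Real.log y + C₁)
        = ρ * Real.log y + ρ * C₁ / I₂ - ε * I₂ * Real.log y - ε * C₁ := by
      field_simp
      ring
    rw [e]
    nlinarith [mul_nonneg hε.le hC₁]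
  have hq3 : (Real.log y * ρ - C₃) / N ≤ (-∑ k ∈ Icc 1 ⌊y⌋₊, T k) / N :=
    div_le_div_of_nonneg_right htot hN0.le
  calc c + 2 / π * (ρ / I₂ - ε)
      ≤ c + 2 / π * ((-∑ k ∈ Icc 1 ⌊y⌋₊, T k) / N) := by
        gcongr
        exact hq2.trans (hq1.trans hq3)
    _ = c - 2 / π * (∑ k ∈ Icc 1 ⌊y⌋₊, T k) / N := by ring

/-! ### §5. The rational certificate and the closer -/

/-- **The rational certificate** at `c₀ = 0.51789`, `a₀ = 1.62699`, `ε = 10⁻⁴`, `η = 1/20000`: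
`c₀ + (2/3.141593)·(ρ(a₀,F)/I₂ − 10⁻⁴) ≥ 1 + 1/20000` for the quadratic weight's profile
(`ρ(a₀,F)/I₂ = 0.75752…`, value `1.00008…`; slack `3.0·10⁻⁵`). Pure `norm_num`; first kernel-checked
by seat rh-crit-ah-t4 g7 (`scratch/CertTest.lean`).
[cite: MontgomeryOdlyzko1984, main theorem as quoted in BuiMilinovichNg2010 §2 p. 3] -/
theorem certificate_quadWeight :
    (1 : ℝ) + 1 / 20000 ≤ (51789 : ℝ) / 100000 + 2 / 3.141593 *
        ((∑ i ∈ range 6, ∑ j ∈ range 6,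
            (-1 : ℝ) ^ i * ((162699 : ℝ) / 100000) ^ (2 * i + 1) / ((2 * i + 1).factorial : ℝ)
              * (fun j : ℕ => ([(4627 : ℝ) / 4000, -1, -387 / 800, 267 / 800, 0, -27 / 4000].getD j 0)) j
                / (2 * i + j + 1)) / (4627 / 4000) - 1 / 10000) := by
  simp only [Finset.sum_range_succ, Finset.sum_range_zero, Nat.factorial, List.getD_cons_zero,
    List.getD_cons_succ]
  norm_num

/-- `ρ(a₀, F) > 0` for the quadratic weight's profile (`ρ = 0.87626…`). [folklore] -/
private theorem rho_quadWeight_pos :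
    (0 : ℝ) < ∑ i ∈ range 6, ∑ j ∈ range 6,
        (-1 : ℝ) ^ i * ((162699 : ℝ) / 100000) ^ (2 * i + 1) / ((2 * i + 1).factorial : ℝ)
          * (fun j : ℕ => ([(4627 : ℝ) / 4000, -1, -387 / 800, 267 / 800, 0, -27 / 4000].getD j 0)) j
            / (2 * i + j + 1) := by
  simp only [Finset.sum_range_succ, Finset.sum_range_zero, Nat.factorial, List.getD_cons_zero,
    List.getD_cons_succ]
  norm_num

/-- `ρ(a₀, F)/I₂ − 10⁻⁴ ≥ 0`. [folklore] -/
private theorem rhoDivI2_sub_eps_nonneg :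
    (0 : ℝ) ≤ (∑ i ∈ range 6, ∑ j ∈ range 6,
        (-1 : ℝ) ^ i * ((162699 : ℝ) / 100000) ^ (2 * i + 1) / ((2 * i + 1).factorial : ℝ)
          * (fun j : ℕ => ([(4627 : ℝ) / 4000, -1, -387 / 800, 267 / 800, 0, -27 / 4000].getD j 0)) j
            / (2 * i + j + 1)) / (4627 / 4000) - 1 / 10000 := by
  simp only [Finset.sum_range_succ, Finset.sum_range_zero, Nat.factorial, List.getD_cons_zero,
    List.getD_cons_succ]
  norm_num

/-! ### §6. The λ-twin: the UNTWISTED family `r(n) = w(log n/Y)/√n` and `T₂₇ ≤ sin`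
(landau-siegel seat ls-lit-r2 g7; consumer `montgomeryOdlyzko1984_largeGaps_holds` below)

For LARGE gaps Montgomery–Odlyzko's family is the untwisted `a_k = f(log k/log y)/√k`
(Bui–Milinovich–Ng 2010 §2 quoting [MO84]: "`a_k = k^{−1/2} f(log k/log K)` … by optimizing over
such functions `f`, the values … `λ > 1.97[99]` are obtained"). The sine argument is now
`a₀ v ≤ a₀ ≈ 6.22 > π`, so `sin` changes sign: the one-sided Taylor bound is applied against
`S_p ≥ 0` (not against the profile), (H2) is used two-sidedly, and the Taylor degree is `27`. -/

/-- (A4′) The degree-`27` Taylor polynomial of `sin` is a lower bound on `[0, ∞)`: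
`Σ_{n<14} (−1)ⁿ x^{2n+1}/(2n+1)! ≤ sin x` for `x ≥ 0`. [folklore] -/
private theorem sinTaylor_27_le_sin (x : ℝ) (hx : 0 ≤ x) :
    ∑ n ∈ range 14, (-1 : ℝ) ^ n * x ^ (2 * n + 1) / ((2 * n + 1).factorial : ℝ) ≤ Real.sin x := by
  have h := sinTaylor_sign 13 x hx
  have e : (-1 : ℝ) ^ (13 + 1) = 1 := by norm_num
  rw [e, one_mul] at h
  linarith

/-- `|Σ_{n<14} (−1)ⁿ x^{2n+1}/(2n+1)!| ≤ x · Σ_{n<14} a^{2n}/(2n+1)!` for `0 ≤ x ≤ a`. [folklore] -/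
private theorem abs_sinTaylor_27_le {x a : ℝ} (hx : 0 ≤ x) (hxa : x ≤ a) :
    |∑ n ∈ range 14, (-1 : ℝ) ^ n * x ^ (2 * n + 1) / ((2 * n + 1).factorial : ℝ)|
      ≤ x * ∑ n ∈ range 14, a ^ (2 * n) / ((2 * n + 1).factorial : ℝ) := by
  refine (Finset.abs_sum_le_sum_abs _ _).trans ?_
  rw [Finset.mul_sum]
  refine Finset.sum_le_sum fun n _ => ?_
  have habs : |(-1 : ℝ) ^ n * x ^ (2 * n + 1) / ((2 * n + 1).factorial : ℝ)|
      = x ^ (2 * n + 1) / ((2 * n + 1).factorial : ℝ) := by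
    rw [abs_div, abs_mul, abs_pow, abs_neg, abs_one, one_pow, one_mul,
      abs_of_nonneg (pow_nonneg hx _), Nat.abs_cast]
  rw [habs, pow_succ, mul_comm (x ^ (2 * n)) x, mul_div_assoc]
  exact mul_le_mul_of_nonneg_left
    (div_le_div_of_nonneg_right (pow_le_pow_left₀ hx hxa _) (by positivity)) hx

/-- `|Σ_{j<m} d_j v^j| ≤ Σ_{j<m} |d_j|` for `v ∈ [0,1]`. [folklore] -/
private theorem abs_sum_mul_pow_le (d : ℕ → ℝ) (m : ℕ) {v : ℝ} (hv0 : 0 ≤ v) (hv1 : v ≤ 1) :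
    |∑ j ∈ range m, d j * v ^ j| ≤ ∑ j ∈ range m, |d j| := by
  refine (Finset.abs_sum_le_sum_abs _ _).trans (Finset.sum_le_sum fun j _ => ?_)
  rw [abs_mul, abs_of_nonneg (pow_nonneg hv0 _)]
  exact mul_le_of_le_one_right (abs_nonneg _) (pow_le_one₀ hv0 hv1)

/-- Term algebra of the untwisted unfolding: with `√k·√k = k`, `√m·√m = m`,
`(Λ/(√k·log k))·s·(w_m/√m)·(w_{km}/(√k√m)) = (Λ/(k log k))·s·(w_m w_{km}/m)`. [folklore] -/
private theorem term_algebra_plain (Λk s wm wkm sk sm lg k m : ℝ) (hsk : sk * sk = k)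
    (hsm : sm * sm = m) (hsk0 : sk ≠ 0) (hsm0 : sm ≠ 0) :
    Λk / (sk * lg) * s * (wm / sm) * (wkm / (sk * sm)) = Λk / (k * lg) * s * (wm * wkm / m) := by
  rcases eq_or_ne lg 0 with hlg | hlg
  · simp [hlg]
  rw [← hsk, ← hsm]
  field_simp

/-- **The unfolded identity for the untwisted family** `r(n) = w(log n/Y)/√n`:
`Re 𝔪(r)(L,h) = (2/π)Σ_{k ≤ L} (Λ(k)/(k log k))·sin((h/2) log k)·S_k`,
`S_k = Σ_{m ≤ L/k} w(log m/Y) w(log(km)/Y)/m` (divisor swap; `√m·√(km)·√k = km`). This is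
Conrey–Ghosh–Gonek's `Σ_{nk ≤ K} a_k a_{nk} g_c(n)Λ(n)n^{−1/2}` for the untwisted family.
[cite: MontgomeryOdlyzko1984, main theorem as quoted in BuiMilinovichNg2010 §2 p. 3] -/
theorem re_moForm_plain (w : ℝ → ℝ) (Y h : ℝ) (L : ℕ) :
    (moForm (fun n => ((w (Real.log n / Y) / Real.sqrt n : ℝ) : ℂ)) L h).re
      = 2 / π * ∑ k ∈ Icc 1 L,
          (Λ k / (k * Real.log k)) * Real.sin (h / 2 * Real.log k)
            * ∑ m ∈ Icc 1 (L / k), w (Real.log m / Y) * w (Real.log (k * m) / Y) / m := by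
  rw [re_moForm_ofReal, sum_Icc_sum_divisors_eq']
  congr 1
  refine Finset.sum_congr rfl fun k hk => ?_
  have hk1 : 1 ≤ k := (Finset.mem_Icc.mp hk).1
  have hkr : (0 : ℝ) < k := by exact_mod_cast hk1
  rw [Finset.mul_sum]
  refine Finset.sum_congr rfl fun m hm => ?_
  have hm1 : 1 ≤ m := (Finset.mem_Icc.mp hm).1
  have hmr : (0 : ℝ) < m := by exact_mod_cast hm1
  rw [Nat.mul_div_cancel_left m (by omega : 0 < k)]
  have hskm : Real.sqrt ((k * m : ℕ) : ℝ) = Real.sqrt k * Real.sqrt m := by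
    push_cast; exact Real.sqrt_mul hkr.le _
  rw [hskm]
  push_cast
  exact term_algebra_plain (Λ k) (Real.sin (h / 2 * Real.log k)) _ _ _ _ (Real.log k) k m
    (Real.mul_self_sqrt hkr.le) (Real.mul_self_sqrt hmr.le)
    (Real.sqrt_pos.mpr hkr).ne' (Real.sqrt_pos.mpr hmr).ne'

/-- **The resonator norm of the untwisted family**: `Σ_{k ≤ L}|w(log k/Y)/√k|² = Σ_{k ≤ L} w(log k/Y)²/k`.
[cite: MontgomeryOdlyzko1984, main theorem as quoted in BuiMilinovichNg2010 §2 p. 3] -/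
theorem coeffNormSq_plain (w : ℝ → ℝ) (Y : ℝ) (L : ℕ) :
    coeffNormSq (fun n => ((w (Real.log n / Y) / Real.sqrt n : ℝ) : ℂ)) L
      = ∑ k ∈ Icc 1 L, w (Real.log k / Y) ^ 2 / k := by
  unfold coeffNormSq
  refine Finset.sum_congr rfl fun k hk => ?_
  have hk1 : 1 ≤ k := (Finset.mem_Icc.mp hk).1
  have hkr : (0 : ℝ) < k := by exact_mod_cast hk1
  rw [Complex.norm_real, Real.norm_eq_abs, sq_abs, div_pow, Real.sq_sqrt hkr.le]

/-- The untwisted unfolded identity at the window `h = 2a/log y`: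
`Re 𝔪 = (2/π)Σ_{k ≤ y} (Λ(k)/(k log k))·sin(a·log k/log y)·S_k`.
[cite: MontgomeryOdlyzko1984, main theorem as quoted in BuiMilinovichNg2010 §2 p. 3] -/
theorem re_moForm_plain_window (w : ℝ → ℝ) (a y : ℝ) :
    (moForm (fun n => ((w (Real.log n / Real.log y) / Real.sqrt n : ℝ) : ℂ)) ⌊y⌋₊
        (2 * a / Real.log y)).re
      = 2 / π * ∑ k ∈ Icc 1 ⌊y⌋₊,
          (Λ k / (k * Real.log k)) * Real.sin (a * (Real.log k / Real.log y))
            * ∑ m ∈ Icc 1 (⌊y⌋₊ / k), w (Real.log m / Real.log y)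
                * w (Real.log (k * m) / Real.log y) / m := by
  rw [re_moForm_plain]
  congr 1
  refine Finset.sum_congr rfl fun k _ => ?_
  congr 2
  ring_nf

/-- **(H1), abstract form, any degree**: if `w(u)² = Σ_{i<N} e_i u^i` then
`Σ_{k ≤ y} w(log k/log y)²/k ≤ (Σ_i e_i/(i+1))·log y + 2Σ_i|e_i|` for `y > 1`.
[cite: Apostol1976, Thm 3.2(a) with Thm 4.2] -/
theorem normSum_le_of_sq_expansion' (w : ℝ → ℝ) (e : ℕ → ℝ) (N : ℕ) {I B y : ℝ}
    (he : ∀ u, w u ^ 2 = ∑ i ∈ range N, e i * u ^ i)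
    (hI : ∑ i ∈ range N, e i / (i + 1) = I) (hB : ∑ i ∈ range N, |e i| ≤ B) (hy : 1 < y) :
    ∑ k ∈ Icc 1 ⌊y⌋₊, w (Real.log k / Real.log y) ^ 2 / k ≤ I * Real.log y + 2 * B := by
  have hY : 0 < Real.log y := Real.log_pos hy
  have hexp : ∑ k ∈ Icc 1 ⌊y⌋₊, w (Real.log k / Real.log y) ^ 2 / k
      = ∑ i ∈ range N, e i / Real.log y ^ i * ∑ k ∈ Icc 1 ⌊y⌋₊, Real.log k ^ i / k := by
    simp_rw [Finset.mul_sum]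
    rw [Finset.sum_comm]
    refine Finset.sum_congr rfl fun k _ => ?_
    rw [he, Finset.sum_div]
    refine Finset.sum_congr rfl fun i _ => ?_
    rw [div_pow]
    ring
  have hmain : ∑ i ∈ range N, e i / Real.log y ^ i * (Real.log y ^ (i + 1) / (i + 1))
      = I * Real.log y := by
    have : ∀ i ∈ range N, e i / Real.log y ^ i * (Real.log y ^ (i + 1) / (i + 1))
        = Real.log y * (e i / (i + 1)) := by
      intro i _
      have hYi : Real.log y ^ i ≠ 0 := pow_ne_zero i hY.ne'
      rw [pow_succ]
      field_simp
    rw [Finset.sum_congr rfl this, ← Finset.mul_sum, hI, mul_comm]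
  have herr := abs_weighted_logMoments_sub_le e N hB hY hy.le le_rfl
  rw [hmain] at herr
  rw [hexp]
  have := (abs_le.mp herr).2
  linarith

/-- **(H2), abstract two-sided form, any degree**: for a prime `p ≤ y` (`y > 1`),
`v = log p/log y`, if `w(u)w(u+v) = Σ_{i<N} c_i u^i` then
`|S_p − (Σ_i c_i(1−v)^{i+1}/(i+1))·log y| ≤ 2Σ|c_i|`,
`S_p = Σ_{m ≤ y/p} w(log m/log y)w(log(pm)/log y)/m`. [cite: Apostol1976, Thm 3.2(a) with Thm 4.2] -/
theorem abs_shiftSum_sub_le_of_expansion (w : ℝ → ℝ) (c : ℕ → ℝ) (N : ℕ) {F B y : ℝ}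
    (hy : 1 < y) {p : ℕ} (hp : p ∈ Nat.primesLE ⌊y⌋₊)
    (hc : ∀ u, w u * w (u + Real.log p / Real.log y) = ∑ i ∈ range N, c i * u ^ i)
    (hF : ∑ i ∈ range N, c i * (1 - Real.log p / Real.log y) ^ (i + 1) / (i + 1) = F)
    (hB : ∑ i ∈ range N, |c i| ≤ B) :
    |∑ m ∈ Icc 1 (⌊y⌋₊ / p), w (Real.log m / Real.log y) * w (Real.log (p * m) / Real.log y) / m
        - F * Real.log y| ≤ 2 * B := by
  have hY : 0 < Real.log y := Real.log_pos hy
  obtain ⟨hpL, hpp⟩ := Nat.mem_primesLE.mp hp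
  have hpr : (0 : ℝ) < p := by exact_mod_cast hpp.pos
  have hy0 : 0 < y := by linarith
  have hpy : (p : ℝ) ≤ y := (show (p : ℝ) ≤ ⌊y⌋₊ by exact_mod_cast hpL).trans (Nat.floor_le hy0.le)
  have hlogp0 : 0 ≤ Real.log p := Real.log_nonneg (by exact_mod_cast hpp.one_lt.le)
  have hlogp : Real.log p ≤ Real.log y := Real.log_le_log hpr hpy
  have hx : 1 ≤ y / p := (one_le_div hpr).mpr hpy
  have hlogx : Real.log (y / p) = Real.log y * (1 - Real.log p / Real.log y) := by
    rw [Real.log_div hy0.ne' hpr.ne']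
    field_simp
  have hlogxY : Real.log (y / p) ≤ Real.log y := by
    rw [Real.log_div hy0.ne' hpr.ne']; linarith
  have hfl : ⌊y⌋₊ / p = ⌊y / p⌋₊ := (Nat.floor_div_natCast y p).symm
  have hexp : ∑ m ∈ Icc 1 (⌊y⌋₊ / p), w (Real.log m / Real.log y) * w (Real.log (p * m) / Real.log y) / m
      = ∑ i ∈ range N, c i / Real.log y ^ i * ∑ m ∈ Icc 1 ⌊y / p⌋₊, Real.log m ^ i / m := by
    rw [hfl]
    simp_rw [Finset.mul_sum]
    rw [Finset.sum_comm]
    refine Finset.sum_congr rfl fun m hm => ?_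
    have hm1 : 1 ≤ m := (Finset.mem_Icc.mp hm).1
    have hmr : (0 : ℝ) < m := by exact_mod_cast hm1
    have hsplit : Real.log ((p : ℝ) * m) / Real.log y
        = Real.log m / Real.log y + Real.log p / Real.log y := by
      rw [Real.log_mul hpr.ne' hmr.ne']
      ring
    rw [hsplit, hc, Finset.sum_div]
    refine Finset.sum_congr rfl fun i _ => ?_
    rw [div_pow]
    ring
  have hmain : ∑ i ∈ range N, c i / Real.log y ^ i * (Real.log (y / p) ^ (i + 1) / (i + 1))
      = F * Real.log y := by
    have : ∀ i ∈ range N, c i / Real.log y ^ i * (Real.log (y / p) ^ (i + 1) / (i + 1))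
        = Real.log y * (c i * (1 - Real.log p / Real.log y) ^ (i + 1) / (i + 1)) := by
      intro i _
      have hYi : Real.log y ^ i ≠ 0 := pow_ne_zero i hY.ne'
      rw [hlogx, mul_pow, pow_succ]
      field_simp
    rw [Finset.sum_congr rfl this, ← Finset.mul_sum, hF, mul_comm]
  have herr := abs_weighted_logMoments_sub_le c N hB hY hx hlogxY
  rw [hmain] at herr
  rw [hexp]
  exact herr

/-- **(H1) for the quartic weight** `w(u) = 1 + (13/2)u(1−u) + 22(u(1−u))²`:
`Σ_{k ≤ y} w(log k/log y)²/k ≤ (3187/360) log y + 13209` for `y > 1`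
(`I₂ = ∫₀¹ w² = 3187/360`, `2Σ|e_i| = 13209`). [cite: Apostol1976, Thm 3.2(a) with Thm 4.2] -/
theorem normSum_quartWeight_le (w : ℝ → ℝ)
    (hw : ∀ u, w u = 1 + 13 / 2 * (u * (1 - u)) + 22 * (u * (1 - u)) ^ 2) {y : ℝ} (hy : 1 < y) :
    ∑ k ∈ Icc 1 ⌊y⌋₊, w (Real.log k / Real.log y) ^ 2 / k ≤ 3187 / 360 * Real.log y + 13209 := by
  have h := normSum_le_of_sq_expansion' w
    (fun i : ℕ => ([(1 : ℝ), 13, 293 / 4, 227 / 2, -1151 / 4, -1078, 2618, -1936, 484].getD i 0)) 9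
    (I := 3187 / 360) (B := 13209 / 2) (y := y) ?_ ?_ ?_ hy
  · linarith
  · intro u
    rw [hw]
    simp only [Finset.sum_range_succ, Finset.sum_range_zero, List.getD_cons_zero,
      List.getD_cons_succ]
    ring
  · simp only [Finset.sum_range_succ, Finset.sum_range_zero, List.getD_cons_zero,
      List.getD_cons_succ]
    norm_num
  · simp only [Finset.sum_range_succ, Finset.sum_range_zero, List.getD_cons_zero,
      List.getD_cons_succ]
    norm_num

/-- **(H2) for the quartic weight**, two-sided: for `y > 1` and every prime `p ≤ y`, with
`v = log p/log y`, `|S_p − F(v)·log y| ≤ 122581`, where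
`F(v) = ∫₀^{1−v} w(u)w(u+v)du = 3187/360 − v − (4651/168)v² − (79/24)v³ + (1859/30)v⁴ −
(5449/120)v⁵ + (22/3)v⁷ − (242/315)v⁹` (`w(u)w(u+v) = Σ_{i<9} c_i(v)u^i`,
`2·sup_{v∈[0,1]} Σ_i|c_i(v)| ≤ 2·Σ_{i,j}|d_{ij}| = 122581`). [cite: Apostol1976, Thm 3.2(a) with Thm 4.2] -/
theorem abs_shiftSum_quartWeight_sub_le (w : ℝ → ℝ)
    (hw : ∀ u, w u = 1 + 13 / 2 * (u * (1 - u)) + 22 * (u * (1 - u)) ^ 2)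
    {y : ℝ} (hy : 1 < y) {p : ℕ} (hp : p ∈ Nat.primesLE ⌊y⌋₊) :
    |∑ m ∈ Icc 1 (⌊y⌋₊ / p), w (Real.log m / Real.log y) * w (Real.log (p * m) / Real.log y) / m
        - (3187 / 360 - Real.log p / Real.log y - 4651 / 168 * (Real.log p / Real.log y) ^ 2
            - 79 / 24 * (Real.log p / Real.log y) ^ 3 + 1859 / 30 * (Real.log p / Real.log y) ^ 4
            - 5449 / 120 * (Real.log p / Real.log y) ^ 5 + 22 / 3 * (Real.log p / Real.log y) ^ 7
            - 242 / 315 * (Real.log p / Real.log y) ^ 9) * Real.log y| ≤ 122581 := by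
  have hY : 0 < Real.log y := Real.log_pos hy
  obtain ⟨hpL, hpp⟩ := Nat.mem_primesLE.mp hp
  have hpr : (0 : ℝ) < p := by exact_mod_cast hpp.pos
  have hy0 : 0 < y := by linarith
  have hpy : (p : ℝ) ≤ y := (show (p : ℝ) ≤ ⌊y⌋₊ by exact_mod_cast hpL).trans (Nat.floor_le hy0.le)
  set v := Real.log p / Real.log y with hv
  have hv0 : 0 ≤ v := div_nonneg (Real.log_nonneg (by exact_mod_cast hpp.one_lt.le)) hY.le
  have hv1 : v ≤ 1 := (div_le_one hY).mpr (Real.log_le_log hpr hpy)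
  set d : ℕ → ℕ → ℝ := (fun i j : ℕ =>
      (([[(1 : ℝ), 13 / 2, 31 / 2, -44, 22],
         [13, 293 / 4, -125 / 4, -198, 143],
         [293 / 4, 681 / 4, -1943 / 4, -110, 341],
         [227 / 2, -1151 / 2, -1870, 3300, -968],
         [-1151 / 4, -2695, 8195, -4840, 484],
         [-1078, 7854, -8712, 1936, 0],
         [2618, -6776, 2904, 0, 0],
         [-1936, 1936, 0, 0, 0],
         [484, 0, 0, 0, 0]].getD i []).getD j 0)) with hd
  have h := abs_shiftSum_sub_le_of_expansion w
    (fun i : ℕ => ∑ j ∈ range 5, d i j * v ^ j) 9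
    (F := 3187 / 360 - v - 4651 / 168 * v ^ 2 - 79 / 24 * v ^ 3 + 1859 / 30 * v ^ 4
        - 5449 / 120 * v ^ 5 + 22 / 3 * v ^ 7 - 242 / 315 * v ^ 9)
    (B := 122581 / 2) hy hp ?_ ?_ ?_
  · linarith
  · intro u
    rw [hw, hw]
    simp only [hd, Finset.sum_range_succ, Finset.sum_range_zero, List.getD_cons_zero,
      List.getD_cons_succ]
    ring
  · simp only [hd, Finset.sum_range_succ, Finset.sum_range_zero, List.getD_cons_zero,
      List.getD_cons_succ]
    ring
  · have hrow : ∀ i ∈ range 9, |∑ j ∈ range 5, d i j * v ^ j| ≤ ∑ j ∈ range 5, |d i j| :=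
      fun i _ => abs_sum_mul_pow_le (d i) 5 hv0 hv1
    refine (Finset.sum_le_sum hrow).trans (le_of_eq ?_)
    simp only [hd, Finset.sum_range_succ, Finset.sum_range_zero, List.getD_cons_zero,
      List.getD_cons_succ]
    norm_num [abs_of_nonneg, abs_of_nonpos]

/-- The weight of each `k` (untwisted): `|Λ(k)/(k log k) · sin(a log k/log y)| ≤ (a/log y)·Λ(k)/k`
for `k ≥ 1`, `a ≥ 0`, `y > 1` (`|sin x| ≤ |x|`; the `k = 1` term is `0 ≤ 0`). [folklore] -/
private theorem abs_weightK_plain_le {a y : ℝ} (ha : 0 ≤ a) (hy : 1 < y) {k : ℕ} (hk : 1 ≤ k) :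
    |Λ k / (k * Real.log k) * Real.sin (a * (Real.log k / Real.log y))|
      ≤ a / Real.log y * (Λ k / k) := by
  have hY : 0 < Real.log y := Real.log_pos hy
  have hkr : (0 : ℝ) < k := by exact_mod_cast hk
  have hΛ : 0 ≤ Λ k := ArithmeticFunction.vonMangoldt_nonneg
  rcases eq_or_lt_of_le (Real.log_nonneg (show (1 : ℝ) ≤ k by exact_mod_cast hk)) with hlog | hlog
  · rw [← hlog]
    simp only [mul_zero, div_zero, zero_mul, abs_zero, zero_div]
    positivity
  have hsin : |Real.sin (a * (Real.log k / Real.log y))| ≤ a * (Real.log k / Real.log y) :=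
    Real.abs_sin_le_abs.trans (le_of_eq (abs_of_nonneg (by positivity)))
  rw [abs_mul, abs_div, abs_of_nonneg hΛ, abs_mul, abs_of_pos hkr, abs_of_pos hlog]
  calc Λ k / (k * Real.log k) * |Real.sin (a * (Real.log k / Real.log y))|
      ≤ Λ k / (k * Real.log k) * (a * (Real.log k / Real.log y)) := by gcongr
    _ = a / Real.log y * (Λ k / k) := by field_simp

/-- (E2′) The non-prime `k` contribute `O(1)` (untwisted):
`|Σ_{k ≤ y, k ∉ ℙ} (Λ(k)/(k log k))·sin(a log k/log y)·S_k| ≤ (a/log y)·M²(1 + log y)·(39/50 + 4)`.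
[cite: Apostol1976, Thm 4.9–4.10 (proof of Thm 4.10)] -/
theorem abs_nonprimeSum_plain_le (w : ℝ → ℝ) {M a y : ℝ} (ha : 0 ≤ a) (hy : 1 < y)
    (hw0 : ∀ u ∈ Set.Icc (0 : ℝ) 1, 0 ≤ w u) (hwM : ∀ u ∈ Set.Icc (0 : ℝ) 1, w u ≤ M) :
    |∑ k ∈ (Finset.Icc 1 ⌊y⌋₊).filter (fun k => ¬ k.Prime),
        (Λ k / (k * Real.log k)) * Real.sin (a * (Real.log k / Real.log y))
          * ∑ m ∈ Icc 1 (⌊y⌋₊ / k), w (Real.log m / Real.log y)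
              * w (Real.log (k * m) / Real.log y) / m|
      ≤ a / Real.log y * (M * M * (1 + Real.log y)) * (39 / 50 + 4) := by
  have hY : 0 < Real.log y := Real.log_pos hy
  have hM : 0 ≤ M := (hw0 0 ⟨le_rfl, zero_le_one⟩).trans (hwM 0 ⟨le_rfl, zero_le_one⟩)
  have hA3 := sum_vonMangoldt_div_not_prime_le hy.le
  refine (Finset.abs_sum_le_sum_abs _ _).trans ?_
  calc ∑ k ∈ (Finset.Icc 1 ⌊y⌋₊).filter (fun k => ¬ k.Prime),
        |(Λ k / (k * Real.log k)) * Real.sin (a * (Real.log k / Real.log y))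
          * ∑ m ∈ Icc 1 (⌊y⌋₊ / k), w (Real.log m / Real.log y)
              * w (Real.log (k * m) / Real.log y) / m|
      ≤ ∑ k ∈ (Finset.Icc 1 ⌊y⌋₊).filter (fun k => ¬ k.Prime),
          a / Real.log y * (Λ k / k) * (M * M * (1 + Real.log y)) := by
        refine Finset.sum_le_sum fun k hk => ?_
        have hk1 : 1 ≤ k := (Finset.mem_Icc.mp (Finset.mem_filter.mp hk).1).1
        obtain ⟨hS0, hSM⟩ := shiftSum_bounds w hy hw0 hwM hk1
        rw [abs_mul, abs_of_nonneg hS0]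
        exact mul_le_mul (abs_weightK_plain_le ha hy hk1) hSM hS0 (by positivity)
    _ = a / Real.log y * (M * M * (1 + Real.log y))
          * ∑ k ∈ (Finset.Icc 1 ⌊y⌋₊).filter (fun k => ¬ k.Prime), Λ k / k := by
        rw [Finset.mul_sum]
        refine Finset.sum_congr rfl fun k _ => ?_
        ring
    _ ≤ a / Real.log y * (M * M * (1 + Real.log y)) * (39 / 50 + 4) :=
        mul_le_mul_of_nonneg_left hA3 (by positivity)

/-- (E3′) On primes the untwisted weight is `Λ(p)/(p log p) = 1/p`, so the prime part of the
unfolded sum is `Σ_{p ≤ y} sin(a log p/log y)·S_p/p`.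
[cite: MontgomeryOdlyzko1984, main theorem as quoted in BuiMilinovichNg2010 §2 p. 3] -/
theorem primeSum_plain_eq (w : ℝ → ℝ) (a y : ℝ) :
    ∑ k ∈ (Finset.Icc 1 ⌊y⌋₊).filter (fun k => k.Prime),
        (Λ k / (k * Real.log k)) * Real.sin (a * (Real.log k / Real.log y))
          * ∑ m ∈ Icc 1 (⌊y⌋₊ / k), w (Real.log m / Real.log y)
              * w (Real.log (k * m) / Real.log y) / m
      = ∑ p ∈ Nat.primesLE ⌊y⌋₊,
          Real.sin (a * (Real.log p / Real.log y)) / p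
            * ∑ m ∈ Icc 1 (⌊y⌋₊ / p), w (Real.log m / Real.log y)
                * w (Real.log (p * m) / Real.log y) / m := by
  rw [filter_prime_Icc_eq_primesLE]
  refine Finset.sum_congr rfl fun p hp => ?_
  have hpp := (Nat.mem_primesLE.mp hp).2
  have hpr : (0 : ℝ) < p := by exact_mod_cast hpp.pos
  have hlog : Real.log p ≠ 0 := (Real.log_pos (by exact_mod_cast hpp.one_lt)).ne'
  rw [ArithmeticFunction.vonMangoldt_apply_prime hpp]
  field_simp

/-- (E4′) **The prime main term of the Taylor side.** For `0 ≤ a`, `y > 1` and ANY coefficient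
vector `F_j` (`j < N`):
`Σ_{p ≤ y} (T₂₇(a v_p)/p)·F(v_p) ≥ ρ₂₇(a,F) − (8/log y)·Q₂₇(a,F)`, `v_p = log p/log y`,
`ρ₂₇ = Σ_{i<14}Σ_{j<N} (−1)^i a^{2i+1}/(2i+1)!·F_j/(2i+j+1)` (`= ∫₀¹ T₂₇(av)F(v)v⁻¹dv`),
`Q₂₇ = Σ_{i,j} a^{2i+1}/(2i+1)!·|F_j|` — the monomial prime sums of (A2), uniformly in the degree.
[cite: MontgomeryOdlyzko1984, main theorem as quoted in BuiMilinovichNg2010 §2 p. 3] -/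
theorem primeSum_taylor27_profile_ge (Fc : ℕ → ℝ) (N : ℕ) {a y : ℝ} (ha : 0 ≤ a) (hy : 1 < y) :
    ∑ i ∈ range 14, ∑ j ∈ range N,
        (-1 : ℝ) ^ i * a ^ (2 * i + 1) / ((2 * i + 1).factorial : ℝ) * Fc j / (2 * i + j + 1)
      - 8 / Real.log y * ∑ i ∈ range 14, ∑ j ∈ range N,
          a ^ (2 * i + 1) / ((2 * i + 1).factorial : ℝ) * |Fc j|
      ≤ ∑ p ∈ Nat.primesLE ⌊y⌋₊,
          (∑ i ∈ range 14, (-1 : ℝ) ^ i * (a * (Real.log p / Real.log y)) ^ (2 * i + 1)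
              / ((2 * i + 1).factorial : ℝ)) / p
            * ∑ j ∈ range N, Fc j * (Real.log p / Real.log y) ^ j := by
  have hY : 0 < Real.log y := Real.log_pos hy
  have hy0 : 0 < y := by linarith
  set q : ℕ → ℕ → ℝ := fun i j =>
    (-1 : ℝ) ^ i * a ^ (2 * i + 1) / ((2 * i + 1).factorial : ℝ) * Fc j with hq
  set P : ℕ → ℝ := fun n =>
    ∑ p ∈ Nat.primesLE ⌊y⌋₊, Real.log p / p * (Real.log p / Real.log y) ^ n with hP
  have habsq : ∀ i j, |q i j| = a ^ (2 * i + 1) / ((2 * i + 1).factorial : ℝ) * |Fc j| := by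
    intro i j
    simp only [hq, abs_mul, abs_div, abs_pow, abs_neg, abs_one, one_pow, one_mul, abs_of_nonneg ha,
      Nat.abs_cast]
  -- the Taylor side is `Σ_{i,j} q_{ij} · P_{2i+j} / log y`
  have hstep2 : ∑ p ∈ Nat.primesLE ⌊y⌋₊,
      (∑ i ∈ range 14, (-1 : ℝ) ^ i * (a * (Real.log p / Real.log y)) ^ (2 * i + 1)
          / ((2 * i + 1).factorial : ℝ)) / p
        * ∑ j ∈ range N, Fc j * (Real.log p / Real.log y) ^ j
      = ∑ i ∈ range 14, ∑ j ∈ range N, q i j / Real.log y * P (2 * i + j) := by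
    have hterm : ∀ p ∈ Nat.primesLE ⌊y⌋₊,
        (∑ i ∈ range 14, (-1 : ℝ) ^ i * (a * (Real.log p / Real.log y)) ^ (2 * i + 1)
            / ((2 * i + 1).factorial : ℝ)) / p
          * ∑ j ∈ range N, Fc j * (Real.log p / Real.log y) ^ j
        = ∑ i ∈ range 14, ∑ j ∈ range N,
            q i j / Real.log y * (Real.log p / p * (Real.log p / Real.log y) ^ (2 * i + j)) := by
      intro p hp
      have hpp := (Nat.mem_primesLE.mp hp).2
      have hpr : (0 : ℝ) < p := by exact_mod_cast hpp.pos
      have hpne : (p : ℝ) ≠ 0 := hpr.ne'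
      have hYne : Real.log y ≠ 0 := hY.ne'
      rw [Finset.sum_div, Finset.sum_mul]
      refine Finset.sum_congr rfl fun i _ => ?_
      rw [Finset.mul_sum]
      refine Finset.sum_congr rfl fun j _ => ?_
      simp only [hq]
      have hv : (Real.log p / Real.log y) ^ (2 * i + 1) * (Real.log p / Real.log y) ^ j
          = (Real.log p / Real.log y) ^ (2 * i + j) * (Real.log p / Real.log y) := by
        rw [← pow_add, ← pow_succ]; congr 1; omega
      calc _ = (-1 : ℝ) ^ i * a ^ (2 * i + 1) / ((2 * i + 1).factorial : ℝ) * Fc j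
            * ((Real.log p / Real.log y) ^ (2 * i + 1) * (Real.log p / Real.log y) ^ j) / p := by
              rw [mul_pow]; ring
        _ = _ := by rw [hv]; ring
    rw [Finset.sum_congr rfl hterm, Finset.sum_comm]
    refine Finset.sum_congr rfl fun i _ => ?_
    rw [Finset.sum_comm]
    refine Finset.sum_congr rfl fun j _ => ?_
    rw [hP, Finset.mul_sum]
  rw [hstep2]
  have hcell : ∀ i ∈ range 14, ∀ j ∈ range N,
      q i j / (2 * i + j + 1) - 8 / Real.log y * |q i j| ≤ q i j / Real.log y * P (2 * i + j) := by
    intro i _ j _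
    have hA := abs_sum_primesLE_logDiv_mul_pow_sub_le (2 * i + j) hy
    have hA' : |P (2 * i + j) - Real.log y / (2 * i + j + 1)| ≤ 8 := by
      simpa [hP] using hA
    have e : q i j / Real.log y * P (2 * i + j)
        = q i j / (2 * i + j + 1) + q i j / Real.log y * (P (2 * i + j) - Real.log y / (2 * i + j + 1)) := by
      field_simp
      ring
    rw [e]
    have hb : |q i j / Real.log y * (P (2 * i + j) - Real.log y / (2 * i + j + 1))|
        ≤ 8 / Real.log y * |q i j| := by
      rw [abs_mul, abs_div, abs_of_pos hY]
      calc |q i j| / Real.log y * |P (2 * i + j) - Real.log y / (2 * i + j + 1)|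
          ≤ |q i j| / Real.log y * 8 := mul_le_mul_of_nonneg_left hA' (by positivity)
        _ = 8 / Real.log y * |q i j| := by ring
    have := neg_abs_le (q i j / Real.log y * (P (2 * i + j) - Real.log y / (2 * i + j + 1)))
    linarith
  have hsum : ∑ i ∈ range 14, ∑ j ∈ range N, (q i j / (2 * i + j + 1) - 8 / Real.log y * |q i j|)
      ≤ ∑ i ∈ range 14, ∑ j ∈ range N, q i j / Real.log y * P (2 * i + j) :=
    Finset.sum_le_sum fun i hi => Finset.sum_le_sum fun j hj => hcell i hi j hj
  have hρ' : ∑ i ∈ range 14, ∑ j ∈ range N,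
        (-1 : ℝ) ^ i * a ^ (2 * i + 1) / ((2 * i + 1).factorial : ℝ) * Fc j / (2 * i + j + 1)
      = ∑ i ∈ range 14, ∑ j ∈ range N, q i j / (2 * i + j + 1) :=
    Finset.sum_congr rfl fun i _ => Finset.sum_congr rfl fun j _ => by simp only [hq]
  have hQ' : 8 / Real.log y * ∑ i ∈ range 14, ∑ j ∈ range N,
        a ^ (2 * i + 1) / ((2 * i + 1).factorial : ℝ) * |Fc j|
      = ∑ i ∈ range 14, ∑ j ∈ range N, 8 / Real.log y * |q i j| := by
    simp_rw [Finset.mul_sum, habsq]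
  have hsplit : ∑ i ∈ range 14, ∑ j ∈ range N, (q i j / (2 * i + j + 1) - 8 / Real.log y * |q i j|)
      = (∑ i ∈ range 14, ∑ j ∈ range N, q i j / (2 * i + j + 1))
        - ∑ i ∈ range 14, ∑ j ∈ range N, 8 / Real.log y * |q i j| := by
    simp only [Finset.sum_sub_distrib]
  linarith [hsum, hρ', hQ', hsplit]

/-- `Σ_{p ≤ y} |T₂₇(a v_p)|/p ≤ A*(a)·(a/log y)(log y + 2)`, `A*(a) = Σ_{n<14} a^{2n}/(2n+1)!`
(`|T₂₇(x)| ≤ x·A*` for `0 ≤ x ≤ a`, then `Σ_p log p/p ≤ log y + 2`).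
[cite: HardyWright2008, Thm 425 (§22.6)] -/
theorem primeSum_abs_taylor27_div_le {a y : ℝ} (ha : 0 ≤ a) (hy : 1 < y) :
    ∑ p ∈ Nat.primesLE ⌊y⌋₊,
        |∑ i ∈ range 14, (-1 : ℝ) ^ i * (a * (Real.log p / Real.log y)) ^ (2 * i + 1)
            / ((2 * i + 1).factorial : ℝ)| / p
      ≤ (∑ n ∈ range 14, a ^ (2 * n) / ((2 * n + 1).factorial : ℝ))
          * (a / Real.log y * (Real.log y + 2)) := by
  have hY : 0 < Real.log y := Real.log_pos hy
  have hy0 : 0 < y := by linarith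
  set A : ℝ := ∑ n ∈ range 14, a ^ (2 * n) / ((2 * n + 1).factorial : ℝ) with hA
  have hA0 : 0 ≤ A := Finset.sum_nonneg fun n _ => by positivity
  have hM := (Literature.NumberTheory.LFunctions.MertensBound.sum_log_div_prime_bounds hy.le).2
  calc ∑ p ∈ Nat.primesLE ⌊y⌋₊,
        |∑ i ∈ range 14, (-1 : ℝ) ^ i * (a * (Real.log p / Real.log y)) ^ (2 * i + 1)
            / ((2 * i + 1).factorial : ℝ)| / p
      ≤ ∑ p ∈ Nat.primesLE ⌊y⌋₊, A * (a / Real.log y) * (Real.log p / p) := by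
        refine Finset.sum_le_sum fun p hp => ?_
        obtain ⟨hpL, hpp⟩ := Nat.mem_primesLE.mp hp
        have hpr : (0 : ℝ) < p := by exact_mod_cast hpp.pos
        have hpy : (p : ℝ) ≤ y :=
          (show (p : ℝ) ≤ ⌊y⌋₊ by exact_mod_cast hpL).trans (Nat.floor_le hy0.le)
        have hlp : 0 ≤ Real.log p := Real.log_nonneg (by exact_mod_cast hpp.one_lt.le)
        have hv1 : Real.log p / Real.log y ≤ 1 := (div_le_one hY).mpr (Real.log_le_log hpr hpy)
        have hx0 : 0 ≤ a * (Real.log p / Real.log y) := by positivity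
        have hxa : a * (Real.log p / Real.log y) ≤ a := by
          calc a * (Real.log p / Real.log y) ≤ a * 1 := by gcongr
            _ = a := mul_one a
        have hT := abs_sinTaylor_27_le hx0 hxa
        calc |∑ i ∈ range 14, (-1 : ℝ) ^ i * (a * (Real.log p / Real.log y)) ^ (2 * i + 1)
                / ((2 * i + 1).factorial : ℝ)| / p
            ≤ (a * (Real.log p / Real.log y) * A) / p := div_le_div_of_nonneg_right hT hpr.le
          _ = A * (a / Real.log y) * (Real.log p / p) := by field_simp
    _ = A * (a / Real.log y) * ∑ p ∈ Nat.primesLE ⌊y⌋₊, Real.log p / p := by rw [Finset.mul_sum]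
    _ ≤ A * (a / Real.log y) * (Real.log y + 2) := mul_le_mul_of_nonneg_left hM (by positivity)
    _ = A * (a / Real.log y * (Real.log y + 2)) := by ring

set_option maxHeartbeats 400000 in
/-- (E6′) **The large-gap engine (untwisted family, two-sided (H2)).** For a weight `0 ≤ w ≤ M`
on `[0,1]` with `w(0) = 1`, a coefficient vector `F_j` (`j < 10`), `a > 0`, and the asymptotic
inputs (H1) `Σ_{k ≤ y} w(log k/log y)²/k ≤ I₂ log y + C₁`,
(H2) `|S_p − F(log p/log y) log y| ≤ C₂` (primes `p ≤ y`), the Montgomery–Odlyzko value of the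
untwisted resonator at the window `h = 2a/log y` satisfies, for every `ε > 0` and all `y` with
`log y` large, `c − Re 𝔪/Σ|r|² ≤ c − (2/π)(ρ₂₇(a,F)/I₂ − ε)` (and `Σ|r|² > 0`): `sin ≥ T₂₇` on
`[0,∞)` is applied against `S_p ≥ 0`.
[cite: MontgomeryOdlyzko1984, main theorem as quoted in BuiMilinovichNg2010 §2 p. 3] -/
theorem moValue_plain_le (w : ℝ → ℝ) (Fc : ℕ → ℝ) {M I₂ C₁ C₂ a ε ρ Q A : ℝ} (c : ℝ)
    (ha : 0 < a) (hε : 0 < ε) (hI₂ : 0 < I₂) (hC₁ : 0 ≤ C₁) (hC₂ : 0 ≤ C₂)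
    (hw0 : ∀ u ∈ Set.Icc (0 : ℝ) 1, 0 ≤ w u) (hwM : ∀ u ∈ Set.Icc (0 : ℝ) 1, w u ≤ M)
    (hw_zero : w 0 = 1)
    (hρ : ρ = ∑ i ∈ range 14, ∑ j ∈ range 10,
        (-1 : ℝ) ^ i * a ^ (2 * i + 1) / ((2 * i + 1).factorial : ℝ) * Fc j / (2 * i + j + 1))
    (hρ0 : 0 < ρ)
    (hQ : Q = ∑ i ∈ range 14, ∑ j ∈ range 10, a ^ (2 * i + 1) / ((2 * i + 1).factorial : ℝ) * |Fc j|)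
    (hAdef : A = ∑ n ∈ range 14, a ^ (2 * n) / ((2 * n + 1).factorial : ℝ))
    (h1 : ∀ y : ℝ, 1 < y →
      ∑ k ∈ Icc 1 ⌊y⌋₊, w (Real.log k / Real.log y) ^ 2 / k ≤ I₂ * Real.log y + C₁)
    (h2 : ∀ y : ℝ, 1 < y → ∀ p ∈ Nat.primesLE ⌊y⌋₊,
      |∑ m ∈ Icc 1 (⌊y⌋₊ / p), w (Real.log m / Real.log y)
            * w (Real.log (p * m) / Real.log y) / m
          - (∑ j ∈ range 10, Fc j * (Real.log p / Real.log y) ^ j) * Real.log y| ≤ C₂) :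
    ∃ Y₁ : ℝ, ∀ y : ℝ, 1 < y → Y₁ ≤ Real.log y →
      0 < coeffNormSq (fun n => ((w (Real.log n / Real.log y) / Real.sqrt n : ℝ) : ℂ)) ⌊y⌋₊ ∧
      c - (moForm (fun n => ((w (Real.log n / Real.log y) / Real.sqrt n : ℝ) : ℂ)) ⌊y⌋₊
              (2 * a / Real.log y)).re
            / coeffNormSq (fun n => ((w (Real.log n / Real.log y) / Real.sqrt n : ℝ) : ℂ)) ⌊y⌋₊
        ≤ c - 2 / π * (ρ / I₂ - ε) := by
  have hM : 0 ≤ M := (hw0 0 ⟨le_rfl, zero_le_one⟩).trans (hwM 0 ⟨le_rfl, zero_le_one⟩)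
  have hQ0 : 0 ≤ Q := by
    rw [hQ]
    exact Finset.sum_nonneg fun i _ => Finset.sum_nonneg fun j _ => by positivity
  have hA0 : 0 ≤ A := by
    rw [hAdef]; exact Finset.sum_nonneg fun n _ => by positivity
  -- the constant absorbing all `O(1)` errors (for `log y ≥ 1`)
  set C₃ : ℝ := 8 * Q + 3 * a * A * C₂ + 10 * a * (M * M) with hC₃
  have hC₃0 : 0 ≤ C₃ := by positivity
  refine ⟨max 1 (max (C₃ / ρ) ((C₃ + ρ * C₁ / I₂) / (ε * I₂))), fun y hy hY₁ => ?_⟩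
  have hY : 0 < Real.log y := Real.log_pos hy
  have hY1 : 1 ≤ Real.log y := le_trans (le_max_left _ _) hY₁
  have hYρ : C₃ / ρ ≤ Real.log y := le_trans ((le_max_left _ _).trans (le_max_right _ _)) hY₁
  have hYε : (C₃ + ρ * C₁ / I₂) / (ε * I₂) ≤ Real.log y :=
    le_trans ((le_max_right _ _).trans (le_max_right _ _)) hY₁
  have hL1 : 1 ≤ ⌊y⌋₊ := Nat.le_floor (by simpa using hy.le)
  rw [coeffNormSq_plain, re_moForm_plain_window]
  set N := ∑ k ∈ Icc 1 ⌊y⌋₊, w (Real.log k / Real.log y) ^ 2 / k with hN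
  have hN1 : 1 ≤ N := by
    have h1mem : 1 ∈ Finset.Icc 1 ⌊y⌋₊ := Finset.mem_Icc.mpr ⟨le_rfl, hL1⟩
    have hle := Finset.single_le_sum (f := fun k : ℕ => w (Real.log k / Real.log y) ^ 2 / k)
      (fun k _ => by positivity) h1mem
    simp only [Nat.cast_one, Real.log_one, zero_div, hw_zero, one_pow, div_one] at hle
    exact hle
  have hN0 : 0 < N := by linarith
  have hNle : N ≤ I₂ * Real.log y + C₁ := h1 y hy
  refine ⟨hN0, ?_⟩
  -- split the `k`-sum into primes and non-primes
  set T : ℕ → ℝ := fun k => (Λ k / (k * Real.log k)) * Real.sin (a * (Real.log k / Real.log y))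
      * ∑ m ∈ Icc 1 (⌊y⌋₊ / k), w (Real.log m / Real.log y)
          * w (Real.log (k * m) / Real.log y) / m with hT
  have hsplit : ∑ k ∈ Icc 1 ⌊y⌋₊, T k
      = (∑ k ∈ (Finset.Icc 1 ⌊y⌋₊).filter (fun k => k.Prime), T k)
        + ∑ k ∈ (Finset.Icc 1 ⌊y⌋₊).filter (fun k => ¬ k.Prime), T k :=
    (Finset.sum_filter_add_sum_filter_not _ _ _).symm
  have hprime : ∑ k ∈ (Finset.Icc 1 ⌊y⌋₊).filter (fun k => k.Prime), T k
      = ∑ p ∈ Nat.primesLE ⌊y⌋₊, Real.sin (a * (Real.log p / Real.log y)) / p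
          * ∑ m ∈ Icc 1 (⌊y⌋₊ / p), w (Real.log m / Real.log y)
              * w (Real.log (p * m) / Real.log y) / m := primeSum_plain_eq w a y
  have hnonprime : |∑ k ∈ (Finset.Icc 1 ⌊y⌋₊).filter (fun k => ¬ k.Prime), T k|
      ≤ a / Real.log y * (M * M * (1 + Real.log y)) * (39 / 50 + 4) :=
    abs_nonprimeSum_plain_le w ha.le hy hw0 hwM
  have hnonprime' : |∑ k ∈ (Finset.Icc 1 ⌊y⌋₊).filter (fun k => ¬ k.Prime), T k|
      ≤ 10 * a * (M * M) := by
    refine hnonprime.trans ?_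
    rw [div_mul_eq_mul_div, div_mul_eq_mul_div, div_le_iff₀ hY]
    nlinarith [mul_nonneg ha.le (mul_nonneg hM hM)]
  -- the prime main term: `Σ_p sin(a v_p) S_p/p ≥ Yρ − 8Q − 3aA C₂`
  have hmain : Real.log y * ρ - 8 * Q - 3 * a * A * C₂
      ≤ ∑ p ∈ Nat.primesLE ⌊y⌋₊, Real.sin (a * (Real.log p / Real.log y)) / p
          * ∑ m ∈ Icc 1 (⌊y⌋₊ / p), w (Real.log m / Real.log y)
              * w (Real.log (p * m) / Real.log y) / m := by
    -- abbreviations per prime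
    have hterm : ∀ p ∈ Nat.primesLE ⌊y⌋₊,
        Real.log y * ((∑ i ∈ range 14, (-1 : ℝ) ^ i * (a * (Real.log p / Real.log y)) ^ (2 * i + 1)
              / ((2 * i + 1).factorial : ℝ)) / p
            * ∑ j ∈ range 10, Fc j * (Real.log p / Real.log y) ^ j)
          - C₂ * (|∑ i ∈ range 14, (-1 : ℝ) ^ i * (a * (Real.log p / Real.log y)) ^ (2 * i + 1)
              / ((2 * i + 1).factorial : ℝ)| / p)
        ≤ Real.sin (a * (Real.log p / Real.log y)) / p
          * ∑ m ∈ Icc 1 (⌊y⌋₊ / p), w (Real.log m / Real.log y)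
              * w (Real.log (p * m) / Real.log y) / m := by
      intro p hp
      obtain ⟨hpL, hpp⟩ := Nat.mem_primesLE.mp hp
      have hpr : (0 : ℝ) < p := by exact_mod_cast hpp.pos
      have hv0 : 0 ≤ Real.log p / Real.log y :=
        div_nonneg (Real.log_nonneg (by exact_mod_cast hpp.one_lt.le)) hY.le
      set Tp : ℝ := ∑ i ∈ range 14, (-1 : ℝ) ^ i * (a * (Real.log p / Real.log y)) ^ (2 * i + 1)
          / ((2 * i + 1).factorial : ℝ) with hTp
      set Sp : ℝ := ∑ m ∈ Icc 1 (⌊y⌋₊ / p), w (Real.log m / Real.log y)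
          * w (Real.log (p * m) / Real.log y) / m with hSp
      set Fp : ℝ := ∑ j ∈ range 10, Fc j * (Real.log p / Real.log y) ^ j with hFp
      obtain ⟨hS0, -⟩ := shiftSum_bounds w hy hw0 hwM (k := p) hpp.one_lt.le
      have hS0' : 0 ≤ Sp := by rw [hSp]; exact hS0
      have hTsin : Tp ≤ Real.sin (a * (Real.log p / Real.log y)) :=
        sinTaylor_27_le_sin _ (by positivity)
      have hdev : |Sp - Fp * Real.log y| ≤ C₂ := by rw [hSp, hFp]; exact h2 y hy p hp
      -- `T·S ≥ T·(F·Y) − |T|·C₂` and `sin·S ≥ T·S`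
      have h1' : Tp * Sp ≤ Real.sin (a * (Real.log p / Real.log y)) * Sp :=
        mul_le_mul_of_nonneg_right hTsin hS0'
      have h2' : Tp * (Fp * Real.log y) - |Tp| * C₂ ≤ Tp * Sp := by
        have h3 : |Tp * (Sp - Fp * Real.log y)| ≤ |Tp| * C₂ := by
          rw [abs_mul]; exact mul_le_mul_of_nonneg_left hdev (abs_nonneg _)
        have h4 := neg_abs_le (Tp * (Sp - Fp * Real.log y))
        nlinarith
      have h5 : Real.log y * (Tp / p * Fp) - C₂ * (|Tp| / p)
          = (Tp * (Fp * Real.log y) - |Tp| * C₂) / p := by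
        field_simp
      rw [h5]
      calc (Tp * (Fp * Real.log y) - |Tp| * C₂) / p ≤ Tp * Sp / p :=
            div_le_div_of_nonneg_right h2' hpr.le
        _ ≤ Real.sin (a * (Real.log p / Real.log y)) * Sp / p :=
            div_le_div_of_nonneg_right h1' hpr.le
        _ = Real.sin (a * (Real.log p / Real.log y)) / p * Sp := by ring
    refine le_trans ?_ (Finset.sum_le_sum hterm)
    rw [Finset.sum_sub_distrib, ← Finset.mul_sum, ← Finset.mul_sum]
    have hE5 := primeSum_taylor27_profile_ge Fc 10 ha.le hy
    rw [← hρ, ← hQ] at hE5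
    have hE4 := primeSum_abs_taylor27_div_le ha.le hy
    rw [← hAdef] at hE4
    have hb1 : Real.log y * (ρ - 8 / Real.log y * Q)
        ≤ Real.log y * ∑ p ∈ Nat.primesLE ⌊y⌋₊,
            (∑ i ∈ range 14, (-1 : ℝ) ^ i * (a * (Real.log p / Real.log y)) ^ (2 * i + 1)
                / ((2 * i + 1).factorial : ℝ)) / p
              * ∑ j ∈ range 10, Fc j * (Real.log p / Real.log y) ^ j :=
      mul_le_mul_of_nonneg_left hE5 hY.le
    have hb2 : C₂ * ∑ p ∈ Nat.primesLE ⌊y⌋₊,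
          |∑ i ∈ range 14, (-1 : ℝ) ^ i * (a * (Real.log p / Real.log y)) ^ (2 * i + 1)
              / ((2 * i + 1).factorial : ℝ)| / p
        ≤ C₂ * (A * (a / Real.log y * (Real.log y + 2))) := mul_le_mul_of_nonneg_left hE4 hC₂
    have e1 : Real.log y * (ρ - 8 / Real.log y * Q) = Real.log y * ρ - 8 * Q := by field_simp
    have e2 : C₂ * (A * (a / Real.log y * (Real.log y + 2))) ≤ 3 * a * A * C₂ := by
      rw [div_mul_eq_mul_div, mul_div_assoc', mul_div_assoc', div_le_iff₀ hY]
      nlinarith [mul_nonneg (mul_nonneg hC₂ hA0) ha.le]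
    linarith
  -- assemble: `Σ_k T k ≥ Y ρ − C₃`
  have htot : Real.log y * ρ - C₃ ≤ ∑ k ∈ Icc 1 ⌊y⌋₊, T k := by
    rw [hsplit, hprime]
    linarith [(abs_le.mp hnonprime').1, hmain]
  -- the quotient
  have hnum0 : 0 ≤ Real.log y * ρ - C₃ := by
    have := (div_le_iff₀ hρ0).mp hYρ
    linarith
  have hden : 0 < I₂ * Real.log y + C₁ := by positivity
  have hq1 : (Real.log y * ρ - C₃) / (I₂ * Real.log y + C₁) ≤ (Real.log y * ρ - C₃) / N :=
    div_le_div_of_nonneg_left hnum0 hN0 hNle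
  have hq2 : ρ / I₂ - ε ≤ (Real.log y * ρ - C₃) / (I₂ * Real.log y + C₁) := by
    rw [le_div_iff₀ hden]
    have hYε' : C₃ + ρ * C₁ / I₂ ≤ ε * I₂ * Real.log y := by
      have := (div_le_iff₀ (by positivity : 0 < ε * I₂)).mp hYε
      linarith
    have e : (ρ / I₂ - ε) * (I₂ * Real.log y + C₁)
        = ρ * Real.log y + ρ * C₁ / I₂ - ε * I₂ * Real.log y - ε * C₁ := by
      field_simp
      ring
    rw [e]
    nlinarith [mul_nonneg hε.le hC₁]
  have hq3 : (Real.log y * ρ - C₃) / N ≤ (∑ k ∈ Icc 1 ⌊y⌋₊, T k) / N :=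
    div_le_div_of_nonneg_right htot hN0.le
  calc c - 2 / π * (∑ k ∈ Icc 1 ⌊y⌋₊, T k) / N
      = c - 2 / π * ((∑ k ∈ Icc 1 ⌊y⌋₊, T k) / N) := by ring
    _ ≤ c - 2 / π * (ρ / I₂ - ε) := by
        gcongr
        exact hq2.trans (hq1.trans hq3)

/-! ### §7. The rational certificate and the closer for `λ > 1.9799` -/

set_option maxHeartbeats 800000 in
/-- **The rational certificate** at `c₀ = 1.97994`, `a₀ = 311/50 = 6.22`, `ε = 10⁻⁶`, `η = 10⁻⁵`:
`c₀ − (2/3.141593)·(ρ₂₇(a₀,F)/I₂ − 10⁻⁶) ≤ 1 − 10⁻⁵` for the quartic weight's profile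
(`(2/π)ρ₂₇/I₂ = 0.9799800…`, slack `2.9·10⁻⁵`; seat numerics `num/cert_exact.py` in exact rational
arithmetic first). Pure `norm_num` over `14 × 10` rational cells.
[cite: MontgomeryOdlyzko1984, main theorem as quoted in BuiMilinovichNg2010 §2 p. 3] -/
theorem certificate_quartWeight :
    (197994 : ℝ) / 100000 - 2 / 3.141593 *
        ((∑ i ∈ range 14, ∑ j ∈ range 10,
            (-1 : ℝ) ^ i * ((311 : ℝ) / 50) ^ (2 * i + 1) / ((2 * i + 1).factorial : ℝ)
              * (fun j : ℕ => ([(3187 : ℝ) / 360, -1, -4651 / 168, -79 / 24, 1859 / 30, -5449 / 120, 0,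
                22 / 3, 0, -242 / 315].getD j 0)) j / (2 * i + j + 1)) / (3187 / 360) - 1 / 1000000)
      ≤ 1 - 1 / 100000 := by
  simp only [Finset.sum_range_succ, Finset.sum_range_zero, Nat.factorial,
    List.getD_cons_zero, List.getD_cons_succ]
  norm_num

set_option maxHeartbeats 800000 in
/-- `ρ₂₇(a₀, F) > 0` for the quartic weight's profile (`ρ₂₇ = 13.6275…`). [folklore] -/
private theorem rho_quartWeight_pos :
    (0 : ℝ) < ∑ i ∈ range 14, ∑ j ∈ range 10,
        (-1 : ℝ) ^ i * ((311 : ℝ) / 50) ^ (2 * i + 1) / ((2 * i + 1).factorial : ℝ)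
          * (fun j : ℕ => ([(3187 : ℝ) / 360, -1, -4651 / 168, -79 / 24, 1859 / 30, -5449 / 120, 0,
                22 / 3, 0, -242 / 315].getD j 0)) j / (2 * i + j + 1) := by
  simp only [Finset.sum_range_succ, Finset.sum_range_zero, Nat.factorial,
    List.getD_cons_zero, List.getD_cons_succ]
  norm_num

set_option maxHeartbeats 800000 in
/-- `ρ₂₇(a₀, F)/I₂ − 10⁻⁶ ≥ 0`. [folklore] -/
private theorem rhoDivI2_quart_sub_eps_nonneg :
    (0 : ℝ) ≤ (∑ i ∈ range 14, ∑ j ∈ range 10,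
        (-1 : ℝ) ^ i * ((311 : ℝ) / 50) ^ (2 * i + 1) / ((2 * i + 1).factorial : ℝ)
          * (fun j : ℕ => ([(3187 : ℝ) / 360, -1, -4651 / 168, -79 / 24, 1859 / 30, -5449 / 120, 0,
                22 / 3, 0, -242 / 315].getD j 0)) j / (2 * i + j + 1)) / (3187 / 360) - 1 / 1000000 := by
  simp only [Finset.sum_range_succ, Finset.sum_range_zero, Nat.factorial,
    List.getD_cons_zero, List.getD_cons_succ]
  norm_num

end MO84

open GoldstonTrudgianTurnageButterbaugh2023 InoueKobayashiToma2025 in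
/-- **Montgomery–Odlyzko 1984: on RH, `μ < 0.5179`** — discharge of the named fact
`montgomeryOdlyzko1984_smallGaps` AS TYPED (`RiemannHypothesis → ZetaGapLiminfBelow 0.5179`).
Proof: the kernel criterion `montgomeryOdlyzko1984_criterion_of_margin` (resonator length
`y = T^{θ₀}`, `θ₀ = a₀/(πc₀)`, margin `η = 1/20000`) fed with the `λ`-weighted quadratic resonator
`a_T(n) = λ(n)(1 + (9/20)u(1−u))/√n`, `u = log n/log y`, whose Montgomery–Odlyzko value is
`≥ c₀ + (2/π)(ρ(a₀,F)/I₂ − 10⁻⁴) ≥ 1 + 1/20000` for all large `T` (`MO84.moValue_liouville_ge` +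
`MO84.certificate_quadWeight`), at `c₀ = 0.51789 < 0.5179` (`ZetaGapLiminfLe.below_of_lt`).
NOT RH-BEARING: RH is the antecedent.
[cite: MontgomeryOdlyzko1984, main theorem as quoted in BuiMilinovichNg2010 §2 p. 3 and FengWu2012 §1 p. 2] -/
theorem montgomeryOdlyzko1984_smallGaps_holds : montgomeryOdlyzko1984_smallGaps := by
  intro hRH
  have hπlo := Real.pi_gt_d6
  have hπhi := Real.pi_lt_d6
  -- constants
  set c₀ : ℝ := 51789 / 100000 with hc₀
  set a₀ : ℝ := 162699 / 100000 with ha₀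
  have hc₀0 : 0 < c₀ := by rw [hc₀]; norm_num
  have ha₀0 : 0 < a₀ := by rw [ha₀]; norm_num
  have hπc : a₀ < π * c₀ := by
    rw [ha₀, hc₀]
    nlinarith
  have ha₀π : a₀ ≤ π := by rw [ha₀]; linarith
  set θ₀ : ℝ := a₀ / (π * c₀) with hθ₀
  have hθ₀0 : 0 < θ₀ := by positivity
  have hθ₀1 : θ₀ < 1 := (div_lt_one (by positivity)).mpr hπc
  -- the weight and its profile
  set w : ℝ → ℝ := fun u => 1 + 9 / 20 * u * (1 - u) with hw
  have hw' : ∀ u, w u = 1 + 9 / 20 * u * (1 - u) := fun u => rfl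
  have hw0 : ∀ u ∈ Set.Icc (0 : ℝ) 1, 0 ≤ w u := by
    intro u hu; rw [hw']; nlinarith [hu.1, hu.2]
  have hwM : ∀ u ∈ Set.Icc (0 : ℝ) 1, w u ≤ 9 / 8 := by
    intro u hu; rw [hw']; nlinarith [hu.1, hu.2, sq_nonneg (u - 1 / 2)]
  have hw_zero : w 0 = 1 := by rw [hw']; ring
  set Fc : ℕ → ℝ := fun j : ℕ =>
    ([(4627 : ℝ) / 4000, -1, -387 / 800, 267 / 800, 0, -27 / 4000].getD j 0) with hFc
  have hFpoly : ∀ v : ℝ, ∑ j ∈ range 6, Fc j * v ^ j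
      = 4627 / 4000 - v - 387 / 800 * v ^ 2 + 267 / 800 * v ^ 3 - 27 / 4000 * v ^ 5 := by
    intro v
    simp only [hFc, Finset.sum_range_succ, Finset.sum_range_zero, List.getD_cons_zero,
      List.getD_cons_succ]
    ring
  have hF : ∀ v ∈ Set.Icc (0 : ℝ) 1, 0 ≤ ∑ j ∈ range 6, Fc j * v ^ j := by
    intro v hv; rw [hFpoly]; exact MO84.profile_quadWeight_nonneg hv.1 hv.2
  have h1 : ∀ y : ℝ, 1 < y →
      ∑ k ∈ Icc 1 ⌊y⌋₊, w (Real.log k / Real.log y) ^ 2 / k ≤ 4627 / 4000 * Real.log y + 7 :=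
    fun y hy => MO84.normSum_quadWeight_le w hw' hy
  have h2 : ∀ y : ℝ, 1 < y → ∀ p ∈ Nat.primesLE ⌊y⌋₊,
      (∑ j ∈ range 6, Fc j * (Real.log p / Real.log y) ^ j) * Real.log y - 13
        ≤ ∑ m ∈ Icc 1 (⌊y⌋₊ / p), w (Real.log m / Real.log y)
            * w (Real.log (p * m) / Real.log y) / m := by
    intro y hy p hp; rw [hFpoly]; exact MO84.shiftSum_quadWeight_ge w hw' hy hp
  have hρ0 := MO84.rho_quadWeight_pos
  -- the engine
  obtain ⟨Y₁, hY₁⟩ := MO84.moValue_liouville_ge w Fc c₀ (M := 9 / 8) (I₂ := 4627 / 4000)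
    (C₁ := 7) (C₂ := 13) (a := a₀) (ε := 1 / 10000) ha₀0 ha₀π (by norm_num) (by norm_num)
    (by norm_num) (by norm_num) hw0 hwM hw_zero hF rfl hρ0 rfl h1 h2
  -- the criterion at `δ₀ = 1 − θ₀`, closed by `c₀ < 0.5179`
  refine ZetaGapLiminfLe.below_of_lt ?_ (show c₀ < 0.5179 by rw [hc₀]; norm_num)
  refine montgomeryOdlyzko1984_criterion_of_margin hRH (1 - θ₀) c₀ (1 / 20000) (by linarith)
    (by linarith) hc₀0 (by norm_num)
    (fun T n => ((((ArithmeticFunction.liouville n : ℤ) : ℝ)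
      * w (Real.log n / Real.log (T ^ θ₀)) / Real.sqrt n : ℝ) : ℂ)) ?_
  refine ⟨max 2 (Real.exp (max Y₁ 1 / θ₀)), fun T hT => ?_⟩
  have hT2 : (2 : ℝ) ≤ T := le_trans (le_max_left _ _) hT
  have hT0 : 0 < T := by linarith
  have hTexp : Real.exp (max Y₁ 1 / θ₀) ≤ T := le_trans (le_max_right _ _) hT
  have hlogT : max Y₁ 1 / θ₀ ≤ Real.log T := (Real.le_log_iff_exp_le hT0).mpr hTexp
  have hlogT0 : 0 < Real.log T := Real.log_pos (by linarith)
  have hlogy : Real.log (T ^ θ₀) = θ₀ * Real.log T := Real.log_rpow hT0 θ₀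
  have hy1 : 1 < T ^ θ₀ := Real.one_lt_rpow (by linarith) hθ₀0
  have hY₁y : Y₁ ≤ Real.log (T ^ θ₀) := by
    rw [hlogy]
    have := (div_le_iff₀ hθ₀0).mp hlogT
    linarith [le_max_left Y₁ 1]
  obtain ⟨hN, hval⟩ := hY₁ (T ^ θ₀) hy1 hY₁y
  have hL : resonatorLength (1 - θ₀) T = ⌊T ^ θ₀⌋₊ := by
    simp only [resonatorLength, sub_sub_cancel]
  have hh : 2 * π * c₀ / Real.log T = 2 * a₀ / Real.log (T ^ θ₀) := by
    rw [hlogy, hθ₀]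
    field_simp
  refine ⟨by rw [hL]; exact hN, ?_⟩
  rw [moFunctional, hL, hh]
  have hX := MO84.rhoDivI2_sub_eps_nonneg
  have hπ' : (2 : ℝ) / 3.141593 ≤ 2 / π := div_le_div_of_nonneg_left (by norm_num) Real.pi_pos hπhi.le
  calc (1 : ℝ) + 1 / 20000
      ≤ c₀ + 2 / 3.141593 * ((∑ i ∈ range 6, ∑ j ∈ range 6,
            (-1 : ℝ) ^ i * a₀ ^ (2 * i + 1) / ((2 * i + 1).factorial : ℝ) * Fc j
                / (2 * i + j + 1)) / (4627 / 4000) - 1 / 10000) := by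
        rw [hc₀, ha₀]; exact MO84.certificate_quadWeight
    _ ≤ c₀ + 2 / π * ((∑ i ∈ range 6, ∑ j ∈ range 6,
            (-1 : ℝ) ^ i * a₀ ^ (2 * i + 1) / ((2 * i + 1).factorial : ℝ) * Fc j
                / (2 * i + j + 1)) / (4627 / 4000) - 1 / 10000) := by
        have hX' : (0 : ℝ) ≤ (∑ i ∈ range 6, ∑ j ∈ range 6,
            (-1 : ℝ) ^ i * a₀ ^ (2 * i + 1) / ((2 * i + 1).factorial : ℝ) * Fc j
                / (2 * i + j + 1)) / (4627 / 4000) - 1 / 10000 := by rw [ha₀]; exact hX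
        nlinarith
    _ ≤ _ := hval

open GoldstonTrudgianTurnageButterbaugh2023 InoueKobayashiToma2025 in
/-- **Montgomery–Odlyzko 1984: on RH, `λ > 1.9799`** — discharge of the named fact
`montgomeryOdlyzko1984_largeGaps` AS TYPED (`RiemannHypothesis → ZetaGapLimsupAbove 1.9799`).
Proof: the kernel criterion `montgomeryOdlyzko1984_criterion_largeGaps_of_margin'` (large-gap
half for every `0 < δ < 1`, Bondarenko–Heap road; resonator length `y = T^{θ₀}`,
`θ₀ = a₀/(πc₀)`, margin `η = 10⁻⁵`) fed with Montgomery–Odlyzko's untwisted family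
`a_T(n) = w(log n/log y)/√n` with the near-optimal quartic `w(u) = 1 + (13/2)u(1−u) + 22(u(1−u))²`
(the optimum over all `w` is the prolate spheroidal wave function; limit functional
`h∞(c) = c − λ₀(πcθ/2)` with `λ₀` the Slepian concentration eigenvalue, crossing `1` at
`c* = 1.97998…` for `θ → 1`, whose rounding DOWN is the printed `1.9799`), whose Montgomery–Odlyzko
value is `≤ c₀ − (2/π)(ρ₂₇(a₀,F)/I₂ − 10⁻⁶) ≤ 1 − 10⁻⁵` for all large `T`
(`MO84.moValue_plain_le` + `MO84.certificate_quartWeight`), at `c₀ = 1.97994 > 1.9799`.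
DECLARED DEVIATIONS FROM PRINT (harmless for the typed statement, which is the NUMBER 1.9799):
(i) `y = T^{θ₀}`, `θ₀ = a₀/(πc₀)` with `a₀ = 311/50` (so that `πc₀θ₀ = a₀` is rational), instead
of `K = T(log T)^{−2}`; (ii) the quartic weight instead of Montgomery–Odlyzko's modified Bessel
function; (iii) `sin ≥ T₂₇` (degree-27 Taylor minorant on `[0,∞)`) against `S_p ≥ 0`.
NOT RH-BEARING: RH is the antecedent.
[cite: MontgomeryOdlyzko1984, main theorem as quoted in BuiMilinovichNg2010 §2 p. 3 and FengWu2012 §1 p. 2] -/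
theorem montgomeryOdlyzko1984_largeGaps_holds : montgomeryOdlyzko1984_largeGaps := by
  intro hRH
  have hπlo := Real.pi_gt_d6
  have hπhi := Real.pi_lt_d6
  -- constants
  set c₀ : ℝ := 197994 / 100000 with hc₀
  set a₀ : ℝ := 311 / 50 with ha₀
  have hc₀0 : 0 < c₀ := by rw [hc₀]; norm_num
  have ha₀0 : 0 < a₀ := by rw [ha₀]; norm_num
  have hπc : a₀ < π * c₀ := by
    rw [ha₀, hc₀]
    nlinarith
  set θ₀ : ℝ := a₀ / (π * c₀) with hθ₀
  have hθ₀0 : 0 < θ₀ := by positivity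
  have hθ₀1 : θ₀ < 1 := (div_lt_one (by positivity)).mpr hπc
  -- the weight and its profile
  set w : ℝ → ℝ := fun u => 1 + 13 / 2 * (u * (1 - u)) + 22 * (u * (1 - u)) ^ 2 with hw
  have hw' : ∀ u, w u = 1 + 13 / 2 * (u * (1 - u)) + 22 * (u * (1 - u)) ^ 2 := fun u => rfl
  have hw0 : ∀ u ∈ Set.Icc (0 : ℝ) 1, 0 ≤ w u := by
    intro u hu; rw [hw']
    have hs : 0 ≤ u * (1 - u) := mul_nonneg hu.1 (by linarith [hu.2])
    positivity
  have hwM : ∀ u ∈ Set.Icc (0 : ℝ) 1, w u ≤ 4 := by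
    intro u hu; rw [hw']
    have hs : 0 ≤ u * (1 - u) := mul_nonneg hu.1 (by linarith [hu.2])
    have hs4 : u * (1 - u) ≤ 1 / 4 := by nlinarith [sq_nonneg (u - 1 / 2)]
    nlinarith
  have hw_zero : w 0 = 1 := by rw [hw']; ring
  set Fc : ℕ → ℝ := fun j : ℕ =>
    ([(3187 : ℝ) / 360, -1, -4651 / 168, -79 / 24, 1859 / 30, -5449 / 120, 0,
      22 / 3, 0, -242 / 315].getD j 0) with hFc
  have hFpoly : ∀ v : ℝ, ∑ j ∈ range 10, Fc j * v ^ j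
      = 3187 / 360 - v - 4651 / 168 * v ^ 2 - 79 / 24 * v ^ 3 + 1859 / 30 * v ^ 4
        - 5449 / 120 * v ^ 5 + 22 / 3 * v ^ 7 - 242 / 315 * v ^ 9 := by
    intro v
    simp only [hFc, Finset.sum_range_succ, Finset.sum_range_zero, List.getD_cons_zero,
      List.getD_cons_succ]
    ring
  have h1 : ∀ y : ℝ, 1 < y →
      ∑ k ∈ Icc 1 ⌊y⌋₊, w (Real.log k / Real.log y) ^ 2 / k ≤ 3187 / 360 * Real.log y + 13209 :=
    fun y hy => MO84.normSum_quartWeight_le w hw' hy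
  have h2 : ∀ y : ℝ, 1 < y → ∀ p ∈ Nat.primesLE ⌊y⌋₊,
      |∑ m ∈ Icc 1 (⌊y⌋₊ / p), w (Real.log m / Real.log y)
            * w (Real.log (p * m) / Real.log y) / m
          - (∑ j ∈ range 10, Fc j * (Real.log p / Real.log y) ^ j) * Real.log y| ≤ 122581 := by
    intro y hy p hp; rw [hFpoly]; exact MO84.abs_shiftSum_quartWeight_sub_le w hw' hy hp
  have hρ0 := MO84.rho_quartWeight_pos
  -- the engine
  obtain ⟨Y₁, hY₁⟩ := MO84.moValue_plain_le w Fc c₀ (M := 4) (I₂ := 3187 / 360)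
    (C₁ := 13209) (C₂ := 122581) (a := a₀) (ε := 1 / 1000000) ha₀0 (by norm_num) (by norm_num)
    (by norm_num) (by norm_num) hw0 hwM hw_zero rfl hρ0 rfl rfl h1 h2
  -- the criterion at `δ₀ = 1 − θ₀`, closed by `1.9799 < c₀`
  refine montgomeryOdlyzko1984_criterion_largeGaps_of_margin' hRH (1 - θ₀) c₀ (1 / 100000)
    (by linarith) (by linarith) hc₀0 (by norm_num)
    (fun T n => ((w (Real.log n / Real.log (T ^ θ₀)) / Real.sqrt n : ℝ) : ℂ)) ?_
    1.9799 (show (1.9799 : ℝ) < c₀ by rw [hc₀]; norm_num)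
  refine ⟨max 2 (Real.exp (max Y₁ 1 / θ₀)), fun T hT => ?_⟩
  have hT2 : (2 : ℝ) ≤ T := le_trans (le_max_left _ _) hT
  have hT0 : 0 < T := by linarith
  have hTexp : Real.exp (max Y₁ 1 / θ₀) ≤ T := le_trans (le_max_right _ _) hT
  have hlogT : max Y₁ 1 / θ₀ ≤ Real.log T := (Real.le_log_iff_exp_le hT0).mpr hTexp
  have hlogT0 : 0 < Real.log T := Real.log_pos (by linarith)
  have hlogy : Real.log (T ^ θ₀) = θ₀ * Real.log T := Real.log_rpow hT0 θ₀
  have hy1 : 1 < T ^ θ₀ := Real.one_lt_rpow (by linarith) hθ₀0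
  have hY₁y : Y₁ ≤ Real.log (T ^ θ₀) := by
    rw [hlogy]
    have := (div_le_iff₀ hθ₀0).mp hlogT
    linarith [le_max_left Y₁ 1]
  obtain ⟨hN, hval⟩ := hY₁ (T ^ θ₀) hy1 hY₁y
  have hL : resonatorLength (1 - θ₀) T = ⌊T ^ θ₀⌋₊ := by
    simp only [resonatorLength, sub_sub_cancel]
  have hh : 2 * π * c₀ / Real.log T = 2 * a₀ / Real.log (T ^ θ₀) := by
    rw [hlogy, hθ₀]
    field_simp
  refine ⟨by rw [hL]; exact hN, ?_⟩
  rw [moFunctional, hL, hh]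
  have hX := MO84.rhoDivI2_quart_sub_eps_nonneg
  have hπ' : (2 : ℝ) / 3.141593 ≤ 2 / π := div_le_div_of_nonneg_left (by norm_num) Real.pi_pos hπhi.le
  calc c₀ - (moForm (fun n => ((w (Real.log n / Real.log (T ^ θ₀)) / Real.sqrt n : ℝ) : ℂ))
          ⌊T ^ θ₀⌋₊ (2 * a₀ / Real.log (T ^ θ₀))).re
        / coeffNormSq (fun n => ((w (Real.log n / Real.log (T ^ θ₀)) / Real.sqrt n : ℝ) : ℂ))
          ⌊T ^ θ₀⌋₊
      ≤ c₀ - 2 / π * ((∑ i ∈ range 14, ∑ j ∈ range 10,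
            (-1 : ℝ) ^ i * a₀ ^ (2 * i + 1) / ((2 * i + 1).factorial : ℝ) * Fc j
                / (2 * i + j + 1)) / (3187 / 360) - 1 / 1000000) := hval
    _ ≤ c₀ - 2 / 3.141593 * ((∑ i ∈ range 14, ∑ j ∈ range 10,
            (-1 : ℝ) ^ i * a₀ ^ (2 * i + 1) / ((2 * i + 1).factorial : ℝ) * Fc j
                / (2 * i + j + 1)) / (3187 / 360) - 1 / 1000000) := by
        have hX' : (0 : ℝ) ≤ (∑ i ∈ range 14, ∑ j ∈ range 10,
            (-1 : ℝ) ^ i * a₀ ^ (2 * i + 1) / ((2 * i + 1).factorial : ℝ) * Fc j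
                / (2 * i + j + 1)) / (3187 / 360) - 1 / 1000000 := by rw [ha₀]; exact hX
        nlinarith
    _ ≤ 1 - 1 / 100000 := by rw [hc₀, ha₀]; exact MO84.certificate_quartWeight

end Literature.NumberTheory.LFunctions

end
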